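import Literature.Analysis.FluidPDE.ElgindiEllipticAssembly
import Literature.Analysis.FluidPDE.ElgindiEllipticHkTools

import HarnessLib

/-!
# The `𝓗⁴` elliptic a-priori estimate in the tree's norm — part D: the datum
([ElgindiGhoulMasmoudi2021] §6 Theorem 3 for `k = 4`; [Elgindi2021] §7.3–7.4)

Topic `Literature/Analysis/FluidPDE`. Proof file (everything proved, no definitions, no named
facts) on the proof path of the named fact
`Literature.Analysis.FluidPDE.Elgindi.ElgindiGhoulMasmoudi2021_stabilityCore`
(`ElgindiStabilityDecomposition.lean`). T. M. Elgindi, T.-E. Ghoul, N. Masmoudi, Camb. J. Math. 9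
(2021) = arXiv:1910.14071, §6 (p. 15 of the held text):

> "**Theorem 3.** Let `k ≥ 2`, `0 < α` sufficiently small and assume `F ∈ 𝓗ᵏ` satisfies the above
> orthogonality condition. Then the unique solution to (6.1) satisfies
> `α²|D_R²Ψ|_{𝓗ᵏ} + α|D_RΨ|_{𝓗ᵏ} + |∂_θθΨ|_{𝓗ᵏ} ≤ C_k|F|_{𝓗ᵏ}` for some `C_k > 0` depending on `k`
> but independent of `α`."

This part bounds the datum `D` of `elliptic_apriori_levels` by `15·689220·|gF|²_{𝓗⁴}` (`gF` the smooth
representative of `F = L(Ψ)`, so `|gF|_{𝓗⁴} = |F|_{𝓗⁴}`): theorem `ofReal_datum_le`.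
-/

noncomputable section

open MeasureTheory Set Real Filter Function Finset
open _root_.Topology
open scoped ENNReal

namespace Literature.Analysis.FluidPDE

namespace Elgindi

set_option linter.unusedSimpArgs false in
set_option linter.unusedTactic false in
set_option linter.unreachableTactic false in
set_option maxRecDepth 4000 in
set_option maxHeartbeats 8000000 in
/-- **The datum against `|F|²_{𝓗⁴}`**: `ofReal D ≤ 15·(ofReal 689220·|gF|²_{𝓗⁴})` where `gF` is the smooth
representative of `F = L(Ψ)`. [cite: ElgindiGhoulMasmoudi2021, §1.7 and §6 Theorem 3 (p. 6, 15 of arXiv:1910.14071)] -/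
theorem ofReal_datum_le {α : ℝ} (hα : 0 < α) (hα4 : α ≤ 1 / 4) {χ : ℝ → ℝ → ℝ}
    (hχ : ContDiff ℝ 10 (uncurry χ)) (hs : HasCompactSupport (uncurry χ)) (hpos : ∀ p ∈ tsupport (uncurry χ), 0 < p.1)
    (hχ0 : ∀ R, χ R 0 = 0) {Ψ gF : ℝ → ℝ → ℝ} (hΨ : Ψ = fun R θ => Real.cos θ * χ R θ)
    (horth : ∀ R, 0 < R → ∫ θ in Ioo 0 (π / 2), ellipticOp α Ψ R θ * kernelK θ = 0)
    (hgF : gF = fun R θ => -α ^ 2 * R ^ 2 * dz (dz Ψ) R θ - α * (5 + α) * R * dz Ψ R θ -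
      dθ (dθ Ψ) R θ + (Real.cos θ * χ R θ + Real.sin θ * dθ χ R θ) - 6 * Ψ R θ)
    {D : ℝ} (hD : D = ((∫ p in strip, radialWeight p.1 ^ 2 * ellipticOp α Ψ p.1 p.2 ^ 2 * Real.sin (2 * p.2) ^ (-eta)) + (∫ p in strip, radialWeight p.1 ^ 2 * (Dz^[1] (ellipticOp α Ψ)) p.1 p.2 ^ 2 * Real.sin (2 * p.2) ^ (-eta)) + (∫ p in strip, radialWeight p.1 ^ 2 * (Dz^[2] (ellipticOp α Ψ)) p.1 p.2 ^ 2 * Real.sin (2 * p.2) ^ (-eta)) + (∫ p in strip, radialWeight p.1 ^ 2 * (Dz^[3] (ellipticOp α Ψ)) p.1 p.2 ^ 2 * Real.sin (2 * p.2) ^ (-eta)) + (∫ p in strip, radialWeight p.1 ^ 2 * (Dz^[4] (ellipticOp α Ψ)) p.1 p.2 ^ 2 * Real.sin (2 * p.2) ^ (-eta)) +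
        (∫ p in strip, radialWeight p.1 ^ 2 * dθ gF p.1 p.2 ^ 2 * Real.sin (2 * p.2) ^ (2 - gammaExp α)) +
        (∫ p in strip, radialWeight p.1 ^ 2 * dθ (Dz^[1] gF) p.1 p.2 ^ 2 * Real.sin (2 * p.2) ^ (2 - gammaExp α)) +
        (∫ p in strip, radialWeight p.1 ^ 2 * dθ (Dz^[2] gF) p.1 p.2 ^ 2 * Real.sin (2 * p.2) ^ (2 - gammaExp α)) +
        (∫ p in strip, radialWeight p.1 ^ 2 * dθ (Dz^[3] gF) p.1 p.2 ^ 2 * Real.sin (2 * p.2) ^ (2 - gammaExp α)) +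
        (∫ p in strip, radialWeight p.1 ^ 2 * dθ (dθ gF) p.1 p.2 ^ 2 * Real.sin (2 * p.2) ^ (4 - gammaExp α)) +
        (∫ p in strip, radialWeight p.1 ^ 2 * dθ (dθ (Dz^[1] gF)) p.1 p.2 ^ 2 * Real.sin (2 * p.2) ^ (4 - gammaExp α)) +
        (∫ p in strip, radialWeight p.1 ^ 2 * dθ (dθ (Dz^[2] gF)) p.1 p.2 ^ 2 * Real.sin (2 * p.2) ^ (4 - gammaExp α)) +
        (∫ p in strip, radialWeight p.1 ^ 2 * (dθ^[3] gF) p.1 p.2 ^ 2 * Real.sin (2 * p.2) ^ (6 - gammaExp α)) +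
        (∫ p in strip, radialWeight p.1 ^ 2 * (dθ^[3] (Dz^[1] gF)) p.1 p.2 ^ 2 * Real.sin (2 * p.2) ^ (6 - gammaExp α)) +
        (∫ p in strip, radialWeight p.1 ^ 2 * (dθ^[4] gF) p.1 p.2 ^ 2 * Real.sin (2 * p.2) ^ (8 - gammaExp α)))) :
    ENNReal.ofReal D ≤ (15 : ℝ≥0∞) * (ENNReal.ofReal 689220 * eHkNormSq α 4 gF) := by
  have hχ8 : ContDiff ℝ 8 (uncurry χ) := hχ.of_le (by norm_num)
  obtain ⟨res10, res11, res12, res13, res20, res21, res22, res30, res31, res40⟩ :=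
    elliptic_apriori_levels hα hα4 hχ8 hs hpos hχ0 hΨ horth hgF hD
  have hα1 : α ≤ 1 := by linarith
  have hα2 : α ^ 2 ≤ 1 := by nlinarith
  have hα4' : α ^ 4 ≤ 1 := by nlinarith
  have hα20 : 0 ≤ α ^ 2 := by positivity
  have hα40 : 0 ≤ α ^ 4 := by positivity
  have hγ1 : 1 < gammaExp α := one_lt_gammaExp hα
  have hγ2 : gammaExp α ≤ 41 / 40 := by unfold gammaExp; linarith
  have hWc : ContinuousOn (fun R => radialWeight R ^ 2) (Ioi 0) := (contDiffOn_radialWeight_sq (n := 0)).continuousOn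
  have hW0 : ∀ R, 0 < R → 0 ≤ (fun R => radialWeight R ^ 2) R := fun R _ => sq_nonneg _
  have hsin : ∀ p ∈ strip, 0 < Real.sin (2 * p.2) := fun p hp => Real.sin_pos_of_pos_of_lt_pi (by linarith [hp.2.1]) (by linarith [hp.2.2])
  -- regularity bookkeeping
  have hΨc : ContDiff ℝ 10 (uncurry Ψ) := by rw [hΨ]; exact contDiff_cosProfile hχ
  have hΨs : HasCompactSupport (uncurry Ψ) := by rw [hΨ]; exact hasCompactSupport_cosProfile hs
  have hΨsub : tsupport (uncurry Ψ) ⊆ tsupport (uncurry χ) := by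
    refine tsupport_subset_of_eq_zero (X := uncurry χ) (g := uncurry Ψ) fun p hp => ?_
    show Ψ p.1 p.2 = 0
    rw [hΨ]; simp [show χ p.1 p.2 = 0 from hp]
  have regχ3 : ∀ m, m ≤ 4 → ContDiff ℝ ((3 + m : ℕ) : WithTop ℕ∞) (uncurry χ) := fun m hm =>
    hχ.of_le (by exact_mod_cast (show 3 + m ≤ 10 by omega))
  have cΨ : ∀ n m : ℕ, n + m ≤ 10 → Continuous fun p : ℝ × ℝ => (dθ^[n] (Dz^[m] Ψ)) p.1 p.2 := by
    intro n m h
    have h1 : ContDiff ℝ ((n + m : ℕ) : WithTop ℕ∞) (uncurry Ψ) := hΨc.of_le (by exact_mod_cast h)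
    have h2 : ContDiff ℝ (n : ℕ) (uncurry (Dz^[m] Ψ)) := contDiff_iterate_Dz_of_contDiff (m := m) (n := n) (by exact_mod_cast h1)
    exact (contDiff_iterate_dθ_of_contDiff (n := n) (m := 0) (by simpa using h2)).continuous
  have sΨ : ∀ n m : ℕ, HasCompactSupport fun p : ℝ × ℝ => (dθ^[n] (Dz^[m] Ψ)) p.1 p.2 := fun n m =>
    hasCompactSupport_iterate_dθ (hasCompactSupport_iterate_Dz hΨs m) n
  have pΨ : ∀ n m : ℕ, ∀ p ∈ tsupport (fun p : ℝ × ℝ => (dθ^[n] (Dz^[m] Ψ)) p.1 p.2), 0 < p.1 := fun n m p hp =>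
    hpos p (hΨsub ((tsupport_iterate_Dz_subset m) ((tsupport_iterate_dθ_subset n) hp)))
  have regΨj4 : ∀ j : ℕ, j ≤ 6 → ContDiff ℝ 4 (uncurry (Dz^[j] Ψ)) := by
    intro j hj
    have h1 : ContDiff ℝ ((4 + j : ℕ) : WithTop ℕ∞) (uncurry Ψ) := hΨc.of_le (by exact_mod_cast (show 4 + j ≤ 10 by omega))
    have := contDiff_iterate_Dz_of_contDiff (m := j) (n := 4) (by exact_mod_cast h1); exact_mod_cast this
  have regΨdd : ∀ j : ℕ, j ≤ 4 → ContDiff ℝ 4 (uncurry (Dz^[j] (dθ (dθ Ψ)))) := by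
    intro j hj
    have h1 : ContDiff ℝ ((4 + j + 1 + 1 : ℕ) : WithTop ℕ∞) (uncurry Ψ) := hΨc.of_le (by exact_mod_cast (show 4 + j + 1 + 1 ≤ 10 by omega))
    have h2 : ContDiff ℝ ((4 + j + 1 : ℕ) : WithTop ℕ∞) (uncurry (dθ Ψ)) := contDiff_dθ_of_contDiff (by exact_mod_cast h1)
    have h3 : ContDiff ℝ ((4 + j : ℕ) : WithTop ℕ∞) (uncurry (dθ (dθ Ψ))) := contDiff_dθ_of_contDiff (by exact_mod_cast h2)
    have := contDiff_iterate_Dz_of_contDiff (m := j) (n := 4) (by exact_mod_cast h3); exact_mod_cast this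
  have regΨnm : ∀ n m : ℕ, n + m + 2 ≤ 10 → ContDiff ℝ ((n + m + 2 : ℕ) : WithTop ℕ∞) (uncurry Ψ) := fun n m h =>
    hΨc.of_le (by exact_mod_cast h)
  have cZ : ∀ m : ℕ, m ≤ 5 → Continuous fun p : ℝ × ℝ => p.1 * dz (dθ (Dz^[m] Ψ)) p.1 p.2 := by
    intro m hm
    have h1 : ContDiff ℝ ((2 + m : ℕ) : WithTop ℕ∞) (uncurry Ψ) := hΨc.of_le (by exact_mod_cast (show 2 + m ≤ 10 by omega))
    have h2 : ContDiff ℝ 2 (uncurry (Dz^[m] Ψ)) := by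
      have := contDiff_iterate_Dz_of_contDiff (m := m) (n := 2) (by exact_mod_cast h1); exact_mod_cast this
    have h3 : ContDiff ℝ 1 (uncurry (dθ (Dz^[m] Ψ))) := contDiff_dθ_of_contDiff h2
    have h4 : ContDiff ℝ 0 (uncurry (dz (dθ (Dz^[m] Ψ)))) := contDiff_dz_of_contDiff h3
    exact continuous_fst.mul h4.continuous
  have sZ : ∀ m : ℕ, HasCompactSupport fun p : ℝ × ℝ => p.1 * dz (dθ (Dz^[m] Ψ)) p.1 p.2 := fun m =>
    (hasCompactSupport_dz (hasCompactSupport_dθ_of (hasCompactSupport_iterate_Dz hΨs m))).mul_left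
  have pZ : ∀ m : ℕ, ∀ p ∈ tsupport (fun p : ℝ × ℝ => p.1 * dz (dθ (Dz^[m] Ψ)) p.1 p.2), 0 < p.1 := by
    intro m p hp
    refine hpos p (hΨsub ((tsupport_iterate_Dz_subset m) ((tsupport_dθ_subset' _) (tsupport_dz_subset ?_))))
    exact (tsupport_mul_subset_right (f := fun p : ℝ × ℝ => p.1) (g := uncurry (dz (dθ (Dz^[m] Ψ))))) hp
  have cdd : ∀ m : ℕ, m ≤ 6 → Continuous fun p : ℝ × ℝ => p.1 ^ 2 * dz (dz (Dz^[m] Ψ)) p.1 p.2 := by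
    intro m hm
    have h2 : ContDiff ℝ 2 (uncurry (Dz^[m] Ψ)) := (regΨj4 m hm).of_le (by norm_num)
    have h3 : ContDiff ℝ 1 (uncurry (dz (Dz^[m] Ψ))) := contDiff_dz_of_contDiff h2
    have h4 : ContDiff ℝ 0 (uncurry (dz (dz (Dz^[m] Ψ)))) := contDiff_dz_of_contDiff h3
    exact (continuous_fst.pow 2).mul h4.continuous
  have sdd : ∀ m : ℕ, HasCompactSupport fun p : ℝ × ℝ => p.1 ^ 2 * dz (dz (Dz^[m] Ψ)) p.1 p.2 := fun m =>
    (hasCompactSupport_dz (hasCompactSupport_dz (hasCompactSupport_iterate_Dz hΨs m))).mul_left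
  have pdd : ∀ m : ℕ, ∀ p ∈ tsupport (fun p : ℝ × ℝ => p.1 ^ 2 * dz (dz (Dz^[m] Ψ)) p.1 p.2), 0 < p.1 := by
    intro m p hp
    refine hpos p (hΨsub ((tsupport_iterate_Dz_subset m) (tsupport_dz_subset (tsupport_dz_subset ?_))))
    exact (tsupport_mul_subset_right (f := fun p : ℝ × ℝ => p.1 ^ 2) (g := uncurry (dz (dz (Dz^[m] Ψ))))) hp
  have cdz : ∀ m : ℕ, m ≤ 6 → Continuous fun p : ℝ × ℝ => dz (Dz^[m] Ψ) p.1 p.2 := by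
    intro m hm
    have h2 : ContDiff ℝ 1 (uncurry (Dz^[m] Ψ)) := (regΨj4 m hm).of_le (by norm_num)
    exact (contDiff_dz_of_contDiff (n := 0) h2).continuous
  have sdz : ∀ m : ℕ, HasCompactSupport fun p : ℝ × ℝ => dz (Dz^[m] Ψ) p.1 p.2 := fun m => hasCompactSupport_dz (hasCompactSupport_iterate_Dz hΨs m)
  have pdz : ∀ m : ℕ, ∀ p ∈ tsupport (fun p : ℝ × ℝ => dz (Dz^[m] Ψ) p.1 p.2), 0 < p.1 := fun m p hp =>
    hpos p (hΨsub ((tsupport_iterate_Dz_subset m) (tsupport_dz_subset hp)))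
  -- the smooth representative
  have hgFc : ContDiff ℝ ((8 : ℕ) : WithTop ℕ∞) (uncurry gF) := contDiff_smoothRep α hΨ hgF (n := 8) (by exact_mod_cast hχ)
  have hgFs : HasCompactSupport (uncurry gF) := hasCompactSupport_smoothRep α hΨ hgF hs
  have hgFsub : tsupport (uncurry gF) ⊆ tsupport (uncurry χ) := tsupport_smoothRep_subset α hΨ hgF
  have hFeq : ∀ p ∈ strip, ellipticOp α Ψ p.1 p.2 = gF p.1 p.2 := ellipticOp_eq_smoothRep α hΨ hgF (hχ.of_le (by norm_num))
  have regF4 : ∀ j : ℕ, j ≤ 4 → ContDiff ℝ 4 (uncurry (Dz^[j] gF)) := by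
    intro j hj
    have h1 : ContDiff ℝ ((4 + j : ℕ) : WithTop ℕ∞) (uncurry gF) := hgFc.of_le (by exact_mod_cast (show 4 + j ≤ 8 by omega))
    have := contDiff_iterate_Dz_of_contDiff (m := j) (n := 4) (by exact_mod_cast h1); exact_mod_cast this
  have cF : ∀ n m : ℕ, n + m ≤ 8 → Continuous fun p : ℝ × ℝ => (dθ^[n] (Dz^[m] gF)) p.1 p.2 := by
    intro n m h
    have h1 : ContDiff ℝ ((n + m : ℕ) : WithTop ℕ∞) (uncurry gF) := hgFc.of_le (by exact_mod_cast h)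
    have h2 : ContDiff ℝ (n : ℕ) (uncurry (Dz^[m] gF)) := contDiff_iterate_Dz_of_contDiff (m := m) (n := n) (by exact_mod_cast h1)
    exact (contDiff_iterate_dθ_of_contDiff (n := n) (m := 0) (by simpa using h2)).continuous
  have sF : ∀ n m : ℕ, HasCompactSupport fun p : ℝ × ℝ => (dθ^[n] (Dz^[m] gF)) p.1 p.2 := fun n m =>
    hasCompactSupport_iterate_dθ (hasCompactSupport_iterate_Dz hgFs m) n
  have pF : ∀ n m : ℕ, ∀ p ∈ tsupport (fun p : ℝ × ℝ => (dθ^[n] (Dz^[m] gF)) p.1 p.2), 0 < p.1 := fun n m p hp =>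
    hpos p (hgFsub ((tsupport_iterate_Dz_subset m) ((tsupport_iterate_dθ_subset n) hp)))
  have cFθ : ∀ n m : ℕ, n + m ≤ 8 → Continuous (uncurry (Dθ^[n] (Dz^[m] gF))) := by
    intro n m h
    have h1 : ContDiff ℝ ((0 + n + m : ℕ) : WithTop ℕ∞) (uncurry gF) := hgFc.of_le (by exact_mod_cast (show 0 + n + m ≤ 8 by omega))
    exact (contDiff_iterate_Dθ_Dz_of_contDiff (i := n) (j := m) (n := 0) (by exact_mod_cast h1)).continuous
  have mF : ∀ n m : ℕ, n + m ≤ 8 → AEMeasurable (uncurry (hkMixedTerm α n m gF)) (volume.restrict strip) := fun n m h =>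
    aemeasurable_hkMixedTerm_of_continuous α (cFθ n m h)
  have mFr : ∀ m : ℕ, m ≤ 8 → AEMeasurable (uncurry (hkRadialTerm m gF)) (volume.restrict strip) := fun m h =>
    aemeasurable_hkRadialTerm_of_continuous (by simpa using cFθ 0 m (by omega))
  -- Step 3 at radial orders 0..4
  obtain ⟨hP0, hZ0, hC0, hR0, hX0, hB0, hY0, hRR0⟩ :=
    polar_singular_apriori_estimate_iterate hα hα4 0 (regχ3 0 (by norm_num)) hs hpos hχ0 hΨ horth
  obtain ⟨hP1, hZ1, hC1, hR1, hX1, hB1, hY1, hRR1⟩ :=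
    polar_singular_apriori_estimate_iterate hα hα4 1 (regχ3 1 (by norm_num)) hs hpos hχ0 hΨ horth
  obtain ⟨hP2, hZ2, hC2, hR2, hX2, hB2, hY2, hRR2⟩ :=
    polar_singular_apriori_estimate_iterate hα hα4 2 (regχ3 2 (by norm_num)) hs hpos hχ0 hΨ horth
  obtain ⟨hP3, hZ3, hC3, hR3, hX3, hB3, hY3, hRR3⟩ :=
    polar_singular_apriori_estimate_iterate hα hα4 3 (regχ3 3 (by norm_num)) hs hpos hχ0 hΨ horth
  obtain ⟨hP4, hZ4, hC4, hR4, hX4, hB4, hY4, hRR4⟩ :=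
    polar_singular_apriori_estimate_iterate hα hα4 4 (regχ3 4 (by norm_num)) hs hpos hχ0 hΨ horth
  try simp only [Function.iterate_zero, id_eq] at hP0 hZ0 hC0 hR0 hX0 hB0 hY0 hRR0
  have nnL0 : 0 ≤ (∫ p in strip, radialWeight p.1 ^ 2 * ellipticOp α Ψ p.1 p.2 ^ 2 * Real.sin (2 * p.2) ^ (-eta)) := setIntegral_nonneg measurableSet_strip fun p hp => strip_integrand_nonneg hp _ _
  have nnL1 : 0 ≤ (∫ p in strip, radialWeight p.1 ^ 2 * (Dz^[1] (ellipticOp α Ψ)) p.1 p.2 ^ 2 * Real.sin (2 * p.2) ^ (-eta)) := setIntegral_nonneg measurableSet_strip fun p hp => strip_integrand_nonneg hp _ _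
  have nnL2 : 0 ≤ (∫ p in strip, radialWeight p.1 ^ 2 * (Dz^[2] (ellipticOp α Ψ)) p.1 p.2 ^ 2 * Real.sin (2 * p.2) ^ (-eta)) := setIntegral_nonneg measurableSet_strip fun p hp => strip_integrand_nonneg hp _ _
  have nnL3 : 0 ≤ (∫ p in strip, radialWeight p.1 ^ 2 * (Dz^[3] (ellipticOp α Ψ)) p.1 p.2 ^ 2 * Real.sin (2 * p.2) ^ (-eta)) := setIntegral_nonneg measurableSet_strip fun p hp => strip_integrand_nonneg hp _ _
  have nnL4 : 0 ≤ (∫ p in strip, radialWeight p.1 ^ 2 * (Dz^[4] (ellipticOp α Ψ)) p.1 p.2 ^ 2 * Real.sin (2 * p.2) ^ (-eta)) := setIntegral_nonneg measurableSet_strip fun p hp => strip_integrand_nonneg hp _ _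
  have nnF10 : 0 ≤ (∫ p in strip, radialWeight p.1 ^ 2 * dθ gF p.1 p.2 ^ 2 * Real.sin (2 * p.2) ^ (2 - gammaExp α)) := setIntegral_nonneg measurableSet_strip fun p hp => strip_integrand_nonneg hp _ _
  have nnF11 : 0 ≤ (∫ p in strip, radialWeight p.1 ^ 2 * dθ (Dz^[1] gF) p.1 p.2 ^ 2 * Real.sin (2 * p.2) ^ (2 - gammaExp α)) := setIntegral_nonneg measurableSet_strip fun p hp => strip_integrand_nonneg hp _ _
  have nnF12 : 0 ≤ (∫ p in strip, radialWeight p.1 ^ 2 * dθ (Dz^[2] gF) p.1 p.2 ^ 2 * Real.sin (2 * p.2) ^ (2 - gammaExp α)) := setIntegral_nonneg measurableSet_strip fun p hp => strip_integrand_nonneg hp _ _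
  have nnF13 : 0 ≤ (∫ p in strip, radialWeight p.1 ^ 2 * dθ (Dz^[3] gF) p.1 p.2 ^ 2 * Real.sin (2 * p.2) ^ (2 - gammaExp α)) := setIntegral_nonneg measurableSet_strip fun p hp => strip_integrand_nonneg hp _ _
  have nnF20 : 0 ≤ (∫ p in strip, radialWeight p.1 ^ 2 * dθ (dθ gF) p.1 p.2 ^ 2 * Real.sin (2 * p.2) ^ (4 - gammaExp α)) := setIntegral_nonneg measurableSet_strip fun p hp => strip_integrand_nonneg hp _ _
  have nnF21 : 0 ≤ (∫ p in strip, radialWeight p.1 ^ 2 * dθ (dθ (Dz^[1] gF)) p.1 p.2 ^ 2 * Real.sin (2 * p.2) ^ (4 - gammaExp α)) := setIntegral_nonneg measurableSet_strip fun p hp => strip_integrand_nonneg hp _ _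
  have nnF22 : 0 ≤ (∫ p in strip, radialWeight p.1 ^ 2 * dθ (dθ (Dz^[2] gF)) p.1 p.2 ^ 2 * Real.sin (2 * p.2) ^ (4 - gammaExp α)) := setIntegral_nonneg measurableSet_strip fun p hp => strip_integrand_nonneg hp _ _
  have nnF30 : 0 ≤ (∫ p in strip, radialWeight p.1 ^ 2 * (dθ^[3] gF) p.1 p.2 ^ 2 * Real.sin (2 * p.2) ^ (6 - gammaExp α)) := setIntegral_nonneg measurableSet_strip fun p hp => strip_integrand_nonneg hp _ _
  have nnF31 : 0 ≤ (∫ p in strip, radialWeight p.1 ^ 2 * (dθ^[3] (Dz^[1] gF)) p.1 p.2 ^ 2 * Real.sin (2 * p.2) ^ (6 - gammaExp α)) := setIntegral_nonneg measurableSet_strip fun p hp => strip_integrand_nonneg hp _ _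
  have nnF40 : 0 ≤ (∫ p in strip, radialWeight p.1 ^ 2 * (dθ^[4] gF) p.1 p.2 ^ 2 * Real.sin (2 * p.2) ^ (8 - gammaExp α)) := setIntegral_nonneg measurableSet_strip fun p hp => strip_integrand_nonneg hp _ _
  have dL0 : (∫ p in strip, radialWeight p.1 ^ 2 * ellipticOp α Ψ p.1 p.2 ^ 2 * Real.sin (2 * p.2) ^ (-eta)) ≤ D := by rw [hD]; linarith only [nnL0, nnL1, nnL2, nnL3, nnL4, nnF10, nnF11, nnF12, nnF13, nnF20, nnF21, nnF22, nnF30, nnF31, nnF40]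
  have dL1 : (∫ p in strip, radialWeight p.1 ^ 2 * (Dz^[1] (ellipticOp α Ψ)) p.1 p.2 ^ 2 * Real.sin (2 * p.2) ^ (-eta)) ≤ D := by rw [hD]; linarith only [nnL0, nnL1, nnL2, nnL3, nnL4, nnF10, nnF11, nnF12, nnF13, nnF20, nnF21, nnF22, nnF30, nnF31, nnF40]
  have dL2 : (∫ p in strip, radialWeight p.1 ^ 2 * (Dz^[2] (ellipticOp α Ψ)) p.1 p.2 ^ 2 * Real.sin (2 * p.2) ^ (-eta)) ≤ D := by rw [hD]; linarith only [nnL0, nnL1, nnL2, nnL3, nnL4, nnF10, nnF11, nnF12, nnF13, nnF20, nnF21, nnF22, nnF30, nnF31, nnF40]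
  have dL3 : (∫ p in strip, radialWeight p.1 ^ 2 * (Dz^[3] (ellipticOp α Ψ)) p.1 p.2 ^ 2 * Real.sin (2 * p.2) ^ (-eta)) ≤ D := by rw [hD]; linarith only [nnL0, nnL1, nnL2, nnL3, nnL4, nnF10, nnF11, nnF12, nnF13, nnF20, nnF21, nnF22, nnF30, nnF31, nnF40]
  have dL4 : (∫ p in strip, radialWeight p.1 ^ 2 * (Dz^[4] (ellipticOp α Ψ)) p.1 p.2 ^ 2 * Real.sin (2 * p.2) ^ (-eta)) ≤ D := by rw [hD]; linarith only [nnL0, nnL1, nnL2, nnL3, nnL4, nnF10, nnF11, nnF12, nnF13, nnF20, nnF21, nnF22, nnF30, nnF31, nnF40]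
  have hD0 : 0 ≤ D := by rw [hD]; linarith only [nnL0, nnL1, nnL2, nnL3, nnL4, nnF10, nnF11, nnF12, nnF13, nnF20, nnF21, nnF22, nnF30, nnF31, nnF40]
  have hr0_1 : (0:ℝ) ≤ 2 - gammaExp α := by linarith
  have hr0_2 : (0:ℝ) ≤ 4 - gammaExp α := by linarith
  have hr0_3 : (0:ℝ) ≤ 6 - gammaExp α := by linarith
  have hr0_4 : (0:ℝ) ≤ 8 - gammaExp α := by linarith
  have nnN10 : 0 ≤ (∫ p in strip, radialWeight p.1 ^ 2 * dθ (dθ χ) p.1 p.2 ^ 2 * Real.sin (2 * p.2) ^ (2 - gammaExp α)) := setIntegral_nonneg measurableSet_strip fun p hp => strip_integrand_nonneg hp _ _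
  have bM10 : (∫ p in strip, radialWeight p.1 ^ 2 * (dθ^[3] Ψ) p.1 p.2 ^ 2 * Real.sin (2 * p.2) ^ (2 - gammaExp α)) ≤ 200000000 * D := by linarith only [res10, nnN10]
  have nnN11 : 0 ≤ (∫ p in strip, radialWeight p.1 ^ 2 * dθ (dθ (Dz^[1] χ)) p.1 p.2 ^ 2 * Real.sin (2 * p.2) ^ (2 - gammaExp α)) := setIntegral_nonneg measurableSet_strip fun p hp => strip_integrand_nonneg hp _ _
  have bM11 : (∫ p in strip, radialWeight p.1 ^ 2 * (dθ^[3] (Dz^[1] Ψ)) p.1 p.2 ^ 2 * Real.sin (2 * p.2) ^ (2 - gammaExp α)) ≤ 200000000 * D := by linarith only [res11, nnN11]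
  have nnN12 : 0 ≤ (∫ p in strip, radialWeight p.1 ^ 2 * dθ (dθ (Dz^[2] χ)) p.1 p.2 ^ 2 * Real.sin (2 * p.2) ^ (2 - gammaExp α)) := setIntegral_nonneg measurableSet_strip fun p hp => strip_integrand_nonneg hp _ _
  have bM12 : (∫ p in strip, radialWeight p.1 ^ 2 * (dθ^[3] (Dz^[2] Ψ)) p.1 p.2 ^ 2 * Real.sin (2 * p.2) ^ (2 - gammaExp α)) ≤ 200000000 * D := by linarith only [res12, nnN12]
  have nnN13 : 0 ≤ (∫ p in strip, radialWeight p.1 ^ 2 * dθ (dθ (Dz^[3] χ)) p.1 p.2 ^ 2 * Real.sin (2 * p.2) ^ (2 - gammaExp α)) := setIntegral_nonneg measurableSet_strip fun p hp => strip_integrand_nonneg hp _ _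
  have bM13 : (∫ p in strip, radialWeight p.1 ^ 2 * (dθ^[3] (Dz^[3] Ψ)) p.1 p.2 ^ 2 * Real.sin (2 * p.2) ^ (2 - gammaExp α)) ≤ 200000000 * D := by linarith only [res13, nnN13]
  have nnN20 : 0 ≤ (∫ p in strip, radialWeight p.1 ^ 2 * (dθ^[3] χ) p.1 p.2 ^ 2 * Real.sin (2 * p.2) ^ (4 - gammaExp α)) := setIntegral_nonneg measurableSet_strip fun p hp => strip_integrand_nonneg hp _ _
  have bM20 : (∫ p in strip, radialWeight p.1 ^ 2 * (dθ^[4] Ψ) p.1 p.2 ^ 2 * Real.sin (2 * p.2) ^ (4 - gammaExp α)) ≤ 3000000000000 * D := by linarith only [res20, nnN20]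
  have nnN21 : 0 ≤ (∫ p in strip, radialWeight p.1 ^ 2 * (dθ^[3] (Dz^[1] χ)) p.1 p.2 ^ 2 * Real.sin (2 * p.2) ^ (4 - gammaExp α)) := setIntegral_nonneg measurableSet_strip fun p hp => strip_integrand_nonneg hp _ _
  have bM21 : (∫ p in strip, radialWeight p.1 ^ 2 * (dθ^[4] (Dz^[1] Ψ)) p.1 p.2 ^ 2 * Real.sin (2 * p.2) ^ (4 - gammaExp α)) ≤ 3000000000000 * D := by linarith only [res21, nnN21]
  have nnN22 : 0 ≤ (∫ p in strip, radialWeight p.1 ^ 2 * (dθ^[3] (Dz^[2] χ)) p.1 p.2 ^ 2 * Real.sin (2 * p.2) ^ (4 - gammaExp α)) := setIntegral_nonneg measurableSet_strip fun p hp => strip_integrand_nonneg hp _ _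
  have bM22 : (∫ p in strip, radialWeight p.1 ^ 2 * (dθ^[4] (Dz^[2] Ψ)) p.1 p.2 ^ 2 * Real.sin (2 * p.2) ^ (4 - gammaExp α)) ≤ 3000000000000 * D := by linarith only [res22, nnN22]
  have nnN30 : 0 ≤ (∫ p in strip, radialWeight p.1 ^ 2 * (dθ^[4] χ) p.1 p.2 ^ 2 * Real.sin (2 * p.2) ^ (6 - gammaExp α)) := setIntegral_nonneg measurableSet_strip fun p hp => strip_integrand_nonneg hp _ _
  have bM30 : (∫ p in strip, radialWeight p.1 ^ 2 * (dθ^[5] Ψ) p.1 p.2 ^ 2 * Real.sin (2 * p.2) ^ (6 - gammaExp α)) ≤ 200000000000000000 * D := by linarith only [res30, nnN30]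
  have nnN31 : 0 ≤ (∫ p in strip, radialWeight p.1 ^ 2 * (dθ^[4] (Dz^[1] χ)) p.1 p.2 ^ 2 * Real.sin (2 * p.2) ^ (6 - gammaExp α)) := setIntegral_nonneg measurableSet_strip fun p hp => strip_integrand_nonneg hp _ _
  have bM31 : (∫ p in strip, radialWeight p.1 ^ 2 * (dθ^[5] (Dz^[1] Ψ)) p.1 p.2 ^ 2 * Real.sin (2 * p.2) ^ (6 - gammaExp α)) ≤ 200000000000000000 * D := by linarith only [res31, nnN31]
  have nnN40 : 0 ≤ (∫ p in strip, radialWeight p.1 ^ 2 * (dθ^[5] χ) p.1 p.2 ^ 2 * Real.sin (2 * p.2) ^ (8 - gammaExp α)) := setIntegral_nonneg measurableSet_strip fun p hp => strip_integrand_nonneg hp _ _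
  have bM40 : (∫ p in strip, radialWeight p.1 ^ 2 * (dθ^[6] Ψ) p.1 p.2 ^ 2 * Real.sin (2 * p.2) ^ (8 - gammaExp α)) ≤ 70000000000000000000000 * D := by linarith only [res40, nnN40]
  -- integrability of the standard integrands
  have iRpow : ∀ {X : ℝ × ℝ → ℝ}, Continuous X → HasCompactSupport X → (∀ p ∈ tsupport X, 0 < p.1) → ∀ {r : ℝ}, 0 ≤ r →
      IntegrableOn (fun p : ℝ × ℝ => radialWeight p.1 ^ 2 * X p ^ 2 * Real.sin (2 * p.2) ^ r) strip := by
    intro X hX hXs hXp r hr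
    have hs2 : HasCompactSupport fun p => X p ^ 2 := hasCompactSupport_of_eq_zero hXs fun p hp => by simp [hp]
    have hp2 : ∀ p ∈ tsupport (fun p => X p ^ 2), 0 < p.1 := fun p hp =>
      hXp p (tsupport_subset_of_eq_zero (X := X) (fun q hq => by simp [hq]) hp)
    exact (integrable_weight_mul_rpow hWc (by fun_prop) hs2 hp2 hr).integrableOn
  have iSing : ∀ {X : ℝ × ℝ → ℝ}, Continuous X → HasCompactSupport X → (∀ p ∈ tsupport X, 0 < p.1) →
      IntegrableOn (fun p : ℝ × ℝ => radialWeight p.1 ^ 2 * X p ^ 2 * Real.sin (2 * p.2) ^ (-eta)) strip := by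
    intro X hX hXs hXp
    have hs2 : HasCompactSupport fun p => X p ^ 2 := hasCompactSupport_of_eq_zero hXs fun p hp => by simp [hp]
    have hp2 : ∀ p ∈ tsupport (fun p => X p ^ 2), 0 < p.1 := fun p hp =>
      hXp p (tsupport_subset_of_eq_zero (X := X) (fun q hq => by simp [hq]) hp)
    obtain ⟨a, ha, hva⟩ := exists_pos_forall_fst_lt_eq_zero hs2 hp2
    have hc : Continuous fun p : ℝ × ℝ => radialWeight p.1 ^ 2 * X p ^ 2 := continuous_weight_mul₂ hWc (by fun_prop) ha hva
    have hcs : HasCompactSupport fun p : ℝ × ℝ => radialWeight p.1 ^ 2 * X p ^ 2 := hasCompactSupport_of_eq_zero hs2 fun p hp => by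
      show radialWeight p.1 ^ 2 * X p ^ 2 = 0
      rw [show X p ^ 2 = 0 from hp, mul_zero]
    exact integrableOn_strip_mul_rpow_of_continuous eta_pos.le (by norm_num [eta]) hc hcs
  have iZ : ∀ {X : ℝ × ℝ → ℝ}, Continuous X → HasCompactSupport X → (∀ p ∈ tsupport X, 0 < p.1) →
      IntegrableOn (fun p : ℝ × ℝ => p.1 ^ 2 * radialWeight p.1 ^ 2 * X p ^ 2 * Real.sin (2 * p.2) ^ (-eta)) strip := by
    intro X hX hXs hXp
    have h := iSing (X := fun p => p.1 * X p) (by fun_prop) hXs.mul_left fun p hp =>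
      hXp p ((tsupport_mul_subset_right (f := fun p : ℝ × ℝ => p.1) (g := X)) hp)
    refine h.congr_fun (fun p _ => by ring) measurableSet_strip
  have i0 : IntegrableOn (fun _ : ℝ × ℝ => (0 : ℝ)) strip := integrableOn_zero
  have nn0 : ∀ p ∈ strip, (0 : ℝ) ≤ (fun _ : ℝ × ℝ => (0 : ℝ)) p := fun p _ => le_rfl
  have z0 : (∫ p in strip, (fun _ : ℝ × ℝ => (0 : ℝ)) p) = 0 := by simp
  have nnW : ∀ p ∈ strip, ∀ (a r : ℝ), 0 ≤ radialWeight p.1 ^ 2 * a ^ 2 * Real.sin (2 * p.2) ^ r := fun p hp a r => strip_integrand_nonneg hp a r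
  have nnZ : ∀ p ∈ strip, ∀ (a r : ℝ), 0 ≤ p.1 ^ 2 * radialWeight p.1 ^ 2 * a ^ 2 * Real.sin (2 * p.2) ^ r := fun p hp a r => strip_integrand_nonneg' hp a r
  have dat_L0 : ENNReal.ofReal (∫ p in strip, radialWeight p.1 ^ 2 * ellipticOp α Ψ p.1 p.2 ^ 2 * Real.sin (2 * p.2) ^ (-eta)) ≤ ENNReal.ofReal 689220 * eHkNormSq α 4 gF := by
    have ig : IntegrableOn (fun p : ℝ × ℝ => radialWeight p.1 ^ 2 * gF p.1 p.2 ^ 2 * Real.sin (2 * p.2) ^ (-eta)) strip := by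
      have := iSing (cF 0 0 (by norm_num)) (sF 0 0) (pF 0 0)
      try simp only [Nat.reduceAdd, Nat.reduceMul, Nat.reducePow, Nat.cast_one, Nat.cast_ofNat, Finset.sum_range_succ, Finset.sum_range_zero, zero_add, Function.iterate_zero, id_eq, iterate_dθ_one, iterate_dθ_two] at this
      exact this
    have ieq : IntegrableOn (fun p : ℝ × ℝ => radialWeight p.1 ^ 2 * ellipticOp α Ψ p.1 p.2 ^ 2 * Real.sin (2 * p.2) ^ (-eta)) strip := by
      refine ig.congr_fun (fun p hp => ?_) measurableSet_strip
      show radialWeight p.1 ^ 2 * gF p.1 p.2 ^ 2 * Real.sin (2 * p.2) ^ (-eta) = radialWeight p.1 ^ 2 * ellipticOp α Ψ p.1 p.2 ^ 2 * Real.sin (2 * p.2) ^ (-eta)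
      rw [hFeq p hp]
    have h := ofReal_setIntegral_le_add4 (H := fun p : ℝ × ℝ => radialWeight p.1 ^ 2 * ellipticOp α Ψ p.1 p.2 ^ 2 * Real.sin (2 * p.2) ^ (-eta)) ieq (fun p hp => nnW p hp _ _)
      (G₁ := hkRadialTerm 0 gF) (G₂ := hkRadialTerm 0 gF) (G₃ := hkRadialTerm 0 gF) (G₄ := hkRadialTerm 0 gF)
      (c₁ := 1) (c₂ := 0) (c₃ := 0) (c₄ := 0) (by norm_num) le_rfl le_rfl le_rfl (mFr 0 (by norm_num)) (mFr 0 (by norm_num)) (mFr 0 (by norm_num)) (mFr 0 (by norm_num))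
      (fun p hp => by
        show radialWeight p.1 ^ 2 * ellipticOp α Ψ p.1 p.2 ^ 2 * Real.sin (2 * p.2) ^ (-eta) ≤ _
        rw [sq_hkRadialTerm 0 _ hp]
        try simp only [Nat.reduceAdd, Nat.reduceMul, Nat.reducePow, Nat.cast_one, Nat.cast_ofNat, Finset.sum_range_succ, Finset.sum_range_zero, zero_add, Function.iterate_zero, id_eq, iterate_dθ_one, iterate_dθ_two]
        rw [← hFeq p hp]
        linarith)
    refine h.trans ?_
    have e1 := eL2Sq_hkRadialTerm_le α (k := 4) (j := 0) (by norm_num) gF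
    calc ENNReal.ofReal 1 * eL2Sq (hkRadialTerm 0 gF) + ENNReal.ofReal 0 * eL2Sq (hkRadialTerm 0 gF) +
          ENNReal.ofReal 0 * eL2Sq (hkRadialTerm 0 gF) + ENNReal.ofReal 0 * eL2Sq (hkRadialTerm 0 gF)
        = eL2Sq (hkRadialTerm 0 gF) := by simp
      _ ≤ eHkNormSq α 4 gF := e1
      _ ≤ ENNReal.ofReal 689220 * eHkNormSq α 4 gF := by
          conv_lhs => rw [← one_mul (eHkNormSq α 4 gF)]
          exact mul_le_mul_left (by rw [← ENNReal.ofReal_one]; exact ENNReal.ofReal_le_ofReal (by norm_num)) _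
  have dat_L1 : ENNReal.ofReal (∫ p in strip, radialWeight p.1 ^ 2 * (Dz^[1] (ellipticOp α Ψ)) p.1 p.2 ^ 2 * Real.sin (2 * p.2) ^ (-eta)) ≤ ENNReal.ofReal 689220 * eHkNormSq α 4 gF := by
    have ig : IntegrableOn (fun p : ℝ × ℝ => radialWeight p.1 ^ 2 * (Dz^[1] gF) p.1 p.2 ^ 2 * Real.sin (2 * p.2) ^ (-eta)) strip := by
      have := iSing (cF 0 1 (by norm_num)) (sF 0 1) (pF 0 1)
      try simp only [Nat.reduceAdd, Nat.reduceMul, Nat.reducePow, Nat.cast_one, Nat.cast_ofNat, Finset.sum_range_succ, Finset.sum_range_zero, zero_add, Function.iterate_zero, id_eq, iterate_dθ_one, iterate_dθ_two] at this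
      exact this
    have ieq : IntegrableOn (fun p : ℝ × ℝ => radialWeight p.1 ^ 2 * (Dz^[1] (ellipticOp α Ψ)) p.1 p.2 ^ 2 * Real.sin (2 * p.2) ^ (-eta)) strip := by
      refine ig.congr_fun (fun p hp => ?_) measurableSet_strip
      show radialWeight p.1 ^ 2 * (Dz^[1] gF) p.1 p.2 ^ 2 * Real.sin (2 * p.2) ^ (-eta) = radialWeight p.1 ^ 2 * (Dz^[1] (ellipticOp α Ψ)) p.1 p.2 ^ 2 * Real.sin (2 * p.2) ^ (-eta)
      rw [iterate_Dz_congr hFeq 1 p hp]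
    have h := ofReal_setIntegral_le_add4 (H := fun p : ℝ × ℝ => radialWeight p.1 ^ 2 * (Dz^[1] (ellipticOp α Ψ)) p.1 p.2 ^ 2 * Real.sin (2 * p.2) ^ (-eta)) ieq (fun p hp => nnW p hp _ _)
      (G₁ := hkRadialTerm 1 gF) (G₂ := hkRadialTerm 1 gF) (G₃ := hkRadialTerm 1 gF) (G₄ := hkRadialTerm 1 gF)
      (c₁ := 1) (c₂ := 0) (c₃ := 0) (c₄ := 0) (by norm_num) le_rfl le_rfl le_rfl (mFr 1 (by norm_num)) (mFr 1 (by norm_num)) (mFr 1 (by norm_num)) (mFr 1 (by norm_num))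
      (fun p hp => by
        show radialWeight p.1 ^ 2 * (Dz^[1] (ellipticOp α Ψ)) p.1 p.2 ^ 2 * Real.sin (2 * p.2) ^ (-eta) ≤ _
        rw [sq_hkRadialTerm 1 _ hp]
        try simp only [Nat.reduceAdd, Nat.reduceMul, Nat.reducePow, Nat.cast_one, Nat.cast_ofNat, Finset.sum_range_succ, Finset.sum_range_zero, zero_add, Function.iterate_zero, id_eq, iterate_dθ_one, iterate_dθ_two]
        rw [← iterate_Dz_congr hFeq 1 p hp]
        linarith)
    refine h.trans ?_
    have e1 := eL2Sq_hkRadialTerm_le α (k := 4) (j := 1) (by norm_num) gF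
    calc ENNReal.ofReal 1 * eL2Sq (hkRadialTerm 1 gF) + ENNReal.ofReal 0 * eL2Sq (hkRadialTerm 1 gF) +
          ENNReal.ofReal 0 * eL2Sq (hkRadialTerm 1 gF) + ENNReal.ofReal 0 * eL2Sq (hkRadialTerm 1 gF)
        = eL2Sq (hkRadialTerm 1 gF) := by simp
      _ ≤ eHkNormSq α 4 gF := e1
      _ ≤ ENNReal.ofReal 689220 * eHkNormSq α 4 gF := by
          conv_lhs => rw [← one_mul (eHkNormSq α 4 gF)]
          exact mul_le_mul_left (by rw [← ENNReal.ofReal_one]; exact ENNReal.ofReal_le_ofReal (by norm_num)) _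
  have dat_L2 : ENNReal.ofReal (∫ p in strip, radialWeight p.1 ^ 2 * (Dz^[2] (ellipticOp α Ψ)) p.1 p.2 ^ 2 * Real.sin (2 * p.2) ^ (-eta)) ≤ ENNReal.ofReal 689220 * eHkNormSq α 4 gF := by
    have ig : IntegrableOn (fun p : ℝ × ℝ => radialWeight p.1 ^ 2 * (Dz^[2] gF) p.1 p.2 ^ 2 * Real.sin (2 * p.2) ^ (-eta)) strip := by
      have := iSing (cF 0 2 (by norm_num)) (sF 0 2) (pF 0 2)
      try simp only [Nat.reduceAdd, Nat.reduceMul, Nat.reducePow, Nat.cast_one, Nat.cast_ofNat, Finset.sum_range_succ, Finset.sum_range_zero, zero_add, Function.iterate_zero, id_eq, iterate_dθ_one, iterate_dθ_two] at this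
      exact this
    have ieq : IntegrableOn (fun p : ℝ × ℝ => radialWeight p.1 ^ 2 * (Dz^[2] (ellipticOp α Ψ)) p.1 p.2 ^ 2 * Real.sin (2 * p.2) ^ (-eta)) strip := by
      refine ig.congr_fun (fun p hp => ?_) measurableSet_strip
      show radialWeight p.1 ^ 2 * (Dz^[2] gF) p.1 p.2 ^ 2 * Real.sin (2 * p.2) ^ (-eta) = radialWeight p.1 ^ 2 * (Dz^[2] (ellipticOp α Ψ)) p.1 p.2 ^ 2 * Real.sin (2 * p.2) ^ (-eta)
      rw [iterate_Dz_congr hFeq 2 p hp]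
    have h := ofReal_setIntegral_le_add4 (H := fun p : ℝ × ℝ => radialWeight p.1 ^ 2 * (Dz^[2] (ellipticOp α Ψ)) p.1 p.2 ^ 2 * Real.sin (2 * p.2) ^ (-eta)) ieq (fun p hp => nnW p hp _ _)
      (G₁ := hkRadialTerm 2 gF) (G₂ := hkRadialTerm 2 gF) (G₃ := hkRadialTerm 2 gF) (G₄ := hkRadialTerm 2 gF)
      (c₁ := 1) (c₂ := 0) (c₃ := 0) (c₄ := 0) (by norm_num) le_rfl le_rfl le_rfl (mFr 2 (by norm_num)) (mFr 2 (by norm_num)) (mFr 2 (by norm_num)) (mFr 2 (by norm_num))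
      (fun p hp => by
        show radialWeight p.1 ^ 2 * (Dz^[2] (ellipticOp α Ψ)) p.1 p.2 ^ 2 * Real.sin (2 * p.2) ^ (-eta) ≤ _
        rw [sq_hkRadialTerm 2 _ hp]
        try simp only [Nat.reduceAdd, Nat.reduceMul, Nat.reducePow, Nat.cast_one, Nat.cast_ofNat, Finset.sum_range_succ, Finset.sum_range_zero, zero_add, Function.iterate_zero, id_eq, iterate_dθ_one, iterate_dθ_two]
        rw [← iterate_Dz_congr hFeq 2 p hp]
        linarith)
    refine h.trans ?_
    have e1 := eL2Sq_hkRadialTerm_le α (k := 4) (j := 2) (by norm_num) gF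
    calc ENNReal.ofReal 1 * eL2Sq (hkRadialTerm 2 gF) + ENNReal.ofReal 0 * eL2Sq (hkRadialTerm 2 gF) +
          ENNReal.ofReal 0 * eL2Sq (hkRadialTerm 2 gF) + ENNReal.ofReal 0 * eL2Sq (hkRadialTerm 2 gF)
        = eL2Sq (hkRadialTerm 2 gF) := by simp
      _ ≤ eHkNormSq α 4 gF := e1
      _ ≤ ENNReal.ofReal 689220 * eHkNormSq α 4 gF := by
          conv_lhs => rw [← one_mul (eHkNormSq α 4 gF)]
          exact mul_le_mul_left (by rw [← ENNReal.ofReal_one]; exact ENNReal.ofReal_le_ofReal (by norm_num)) _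
  have dat_L3 : ENNReal.ofReal (∫ p in strip, radialWeight p.1 ^ 2 * (Dz^[3] (ellipticOp α Ψ)) p.1 p.2 ^ 2 * Real.sin (2 * p.2) ^ (-eta)) ≤ ENNReal.ofReal 689220 * eHkNormSq α 4 gF := by
    have ig : IntegrableOn (fun p : ℝ × ℝ => radialWeight p.1 ^ 2 * (Dz^[3] gF) p.1 p.2 ^ 2 * Real.sin (2 * p.2) ^ (-eta)) strip := by
      have := iSing (cF 0 3 (by norm_num)) (sF 0 3) (pF 0 3)
      try simp only [Nat.reduceAdd, Nat.reduceMul, Nat.reducePow, Nat.cast_one, Nat.cast_ofNat, Finset.sum_range_succ, Finset.sum_range_zero, zero_add, Function.iterate_zero, id_eq, iterate_dθ_one, iterate_dθ_two] at this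
      exact this
    have ieq : IntegrableOn (fun p : ℝ × ℝ => radialWeight p.1 ^ 2 * (Dz^[3] (ellipticOp α Ψ)) p.1 p.2 ^ 2 * Real.sin (2 * p.2) ^ (-eta)) strip := by
      refine ig.congr_fun (fun p hp => ?_) measurableSet_strip
      show radialWeight p.1 ^ 2 * (Dz^[3] gF) p.1 p.2 ^ 2 * Real.sin (2 * p.2) ^ (-eta) = radialWeight p.1 ^ 2 * (Dz^[3] (ellipticOp α Ψ)) p.1 p.2 ^ 2 * Real.sin (2 * p.2) ^ (-eta)
      rw [iterate_Dz_congr hFeq 3 p hp]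
    have h := ofReal_setIntegral_le_add4 (H := fun p : ℝ × ℝ => radialWeight p.1 ^ 2 * (Dz^[3] (ellipticOp α Ψ)) p.1 p.2 ^ 2 * Real.sin (2 * p.2) ^ (-eta)) ieq (fun p hp => nnW p hp _ _)
      (G₁ := hkRadialTerm 3 gF) (G₂ := hkRadialTerm 3 gF) (G₃ := hkRadialTerm 3 gF) (G₄ := hkRadialTerm 3 gF)
      (c₁ := 1) (c₂ := 0) (c₃ := 0) (c₄ := 0) (by norm_num) le_rfl le_rfl le_rfl (mFr 3 (by norm_num)) (mFr 3 (by norm_num)) (mFr 3 (by norm_num)) (mFr 3 (by norm_num))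
      (fun p hp => by
        show radialWeight p.1 ^ 2 * (Dz^[3] (ellipticOp α Ψ)) p.1 p.2 ^ 2 * Real.sin (2 * p.2) ^ (-eta) ≤ _
        rw [sq_hkRadialTerm 3 _ hp]
        try simp only [Nat.reduceAdd, Nat.reduceMul, Nat.reducePow, Nat.cast_one, Nat.cast_ofNat, Finset.sum_range_succ, Finset.sum_range_zero, zero_add, Function.iterate_zero, id_eq, iterate_dθ_one, iterate_dθ_two]
        rw [← iterate_Dz_congr hFeq 3 p hp]
        linarith)
    refine h.trans ?_
    have e1 := eL2Sq_hkRadialTerm_le α (k := 4) (j := 3) (by norm_num) gF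
    calc ENNReal.ofReal 1 * eL2Sq (hkRadialTerm 3 gF) + ENNReal.ofReal 0 * eL2Sq (hkRadialTerm 3 gF) +
          ENNReal.ofReal 0 * eL2Sq (hkRadialTerm 3 gF) + ENNReal.ofReal 0 * eL2Sq (hkRadialTerm 3 gF)
        = eL2Sq (hkRadialTerm 3 gF) := by simp
      _ ≤ eHkNormSq α 4 gF := e1
      _ ≤ ENNReal.ofReal 689220 * eHkNormSq α 4 gF := by
          conv_lhs => rw [← one_mul (eHkNormSq α 4 gF)]
          exact mul_le_mul_left (by rw [← ENNReal.ofReal_one]; exact ENNReal.ofReal_le_ofReal (by norm_num)) _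
  have dat_L4 : ENNReal.ofReal (∫ p in strip, radialWeight p.1 ^ 2 * (Dz^[4] (ellipticOp α Ψ)) p.1 p.2 ^ 2 * Real.sin (2 * p.2) ^ (-eta)) ≤ ENNReal.ofReal 689220 * eHkNormSq α 4 gF := by
    have ig : IntegrableOn (fun p : ℝ × ℝ => radialWeight p.1 ^ 2 * (Dz^[4] gF) p.1 p.2 ^ 2 * Real.sin (2 * p.2) ^ (-eta)) strip := by
      have := iSing (cF 0 4 (by norm_num)) (sF 0 4) (pF 0 4)
      try simp only [Nat.reduceAdd, Nat.reduceMul, Nat.reducePow, Nat.cast_one, Nat.cast_ofNat, Finset.sum_range_succ, Finset.sum_range_zero, zero_add, Function.iterate_zero, id_eq, iterate_dθ_one, iterate_dθ_two] at this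
      exact this
    have ieq : IntegrableOn (fun p : ℝ × ℝ => radialWeight p.1 ^ 2 * (Dz^[4] (ellipticOp α Ψ)) p.1 p.2 ^ 2 * Real.sin (2 * p.2) ^ (-eta)) strip := by
      refine ig.congr_fun (fun p hp => ?_) measurableSet_strip
      show radialWeight p.1 ^ 2 * (Dz^[4] gF) p.1 p.2 ^ 2 * Real.sin (2 * p.2) ^ (-eta) = radialWeight p.1 ^ 2 * (Dz^[4] (ellipticOp α Ψ)) p.1 p.2 ^ 2 * Real.sin (2 * p.2) ^ (-eta)
      rw [iterate_Dz_congr hFeq 4 p hp]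
    have h := ofReal_setIntegral_le_add4 (H := fun p : ℝ × ℝ => radialWeight p.1 ^ 2 * (Dz^[4] (ellipticOp α Ψ)) p.1 p.2 ^ 2 * Real.sin (2 * p.2) ^ (-eta)) ieq (fun p hp => nnW p hp _ _)
      (G₁ := hkRadialTerm 4 gF) (G₂ := hkRadialTerm 4 gF) (G₃ := hkRadialTerm 4 gF) (G₄ := hkRadialTerm 4 gF)
      (c₁ := 1) (c₂ := 0) (c₃ := 0) (c₄ := 0) (by norm_num) le_rfl le_rfl le_rfl (mFr 4 (by norm_num)) (mFr 4 (by norm_num)) (mFr 4 (by norm_num)) (mFr 4 (by norm_num))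
      (fun p hp => by
        show radialWeight p.1 ^ 2 * (Dz^[4] (ellipticOp α Ψ)) p.1 p.2 ^ 2 * Real.sin (2 * p.2) ^ (-eta) ≤ _
        rw [sq_hkRadialTerm 4 _ hp]
        try simp only [Nat.reduceAdd, Nat.reduceMul, Nat.reducePow, Nat.cast_one, Nat.cast_ofNat, Finset.sum_range_succ, Finset.sum_range_zero, zero_add, Function.iterate_zero, id_eq, iterate_dθ_one, iterate_dθ_two]
        rw [← iterate_Dz_congr hFeq 4 p hp]
        linarith)
    refine h.trans ?_
    have e1 := eL2Sq_hkRadialTerm_le α (k := 4) (j := 4) (by norm_num) gF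
    calc ENNReal.ofReal 1 * eL2Sq (hkRadialTerm 4 gF) + ENNReal.ofReal 0 * eL2Sq (hkRadialTerm 4 gF) +
          ENNReal.ofReal 0 * eL2Sq (hkRadialTerm 4 gF) + ENNReal.ofReal 0 * eL2Sq (hkRadialTerm 4 gF)
        = eL2Sq (hkRadialTerm 4 gF) := by simp
      _ ≤ eHkNormSq α 4 gF := e1
      _ ≤ ENNReal.ofReal 689220 * eHkNormSq α 4 gF := by
          conv_lhs => rw [← one_mul (eHkNormSq α 4 gF)]
          exact mul_le_mul_left (by rw [← ENNReal.ofReal_one]; exact ENNReal.ofReal_le_ofReal (by norm_num)) _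
  have dat_F10 : ENNReal.ofReal (∫ p in strip, radialWeight p.1 ^ 2 * dθ gF p.1 p.2 ^ 2 * Real.sin (2 * p.2) ^ (2 - gammaExp α)) ≤ ENNReal.ofReal 689220 * eHkNormSq α 4 gF := by
    have ieq : IntegrableOn (fun p : ℝ × ℝ => radialWeight p.1 ^ 2 * dθ gF p.1 p.2 ^ 2 * Real.sin (2 * p.2) ^ (2 - gammaExp α)) strip := by
      have := iRpow (cF 1 0 (by norm_num)) (sF 1 0) (pF 1 0) hr0_1
      try simp only [Nat.reduceAdd, Nat.reduceMul, Nat.reducePow, Nat.cast_one, Nat.cast_ofNat, Finset.sum_range_succ, Finset.sum_range_zero, zero_add, Function.iterate_zero, id_eq, iterate_dθ_one, iterate_dθ_two] at this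
      exact this
    have h := ofReal_setIntegral_le_add4 (H := fun p : ℝ × ℝ => radialWeight p.1 ^ 2 * dθ gF p.1 p.2 ^ 2 * Real.sin (2 * p.2) ^ (2 - gammaExp α)) ieq (fun p hp => nnW p hp _ _)
      (G₁ := hkMixedTerm α 1 0 gF) (G₂ := hkMixedTerm α 2 0 gF) (G₃ := hkMixedTerm α 3 0 gF) (G₄ := hkMixedTerm α 4 0 gF)
      (c₁ := 1) (c₂ := 0) (c₃ := 0) (c₄ := 0) (by norm_num) (by norm_num) (by norm_num) (by norm_num)
      (mF 1 0 (by norm_num)) (mF 2 0 (by norm_num)) (mF 3 0 (by norm_num)) (mF 4 0 (by norm_num))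
      (fun p hp => by
        show radialWeight p.1 ^ 2 * dθ gF p.1 p.2 ^ 2 * Real.sin (2 * p.2) ^ (2 - gammaExp α) ≤ _
        rw [sq_hkMixedTerm α 1 0 _ hp, sq_hkMixedTerm α 2 0 _ hp, sq_hkMixedTerm α 3 0 _ hp, sq_hkMixedTerm α 4 0 _ hp]
        have dn := down_one (regF4 0 (by norm_num)) (gammaExp α) hp
        try simp only [Nat.reduceAdd, Nat.reduceMul, Nat.reducePow, Nat.cast_one, Nat.cast_ofNat, Finset.sum_range_succ, Finset.sum_range_zero, zero_add, Function.iterate_zero, id_eq, iterate_dθ_one, iterate_dθ_two] at dn ⊢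
        nlinarith only [dn, nnW p hp ((Dθ^[1] gF) p.1 p.2) (-gammaExp α), nnW p hp ((Dθ^[2] gF) p.1 p.2) (-gammaExp α),
          nnW p hp ((Dθ^[3] gF) p.1 p.2) (-gammaExp α), nnW p hp ((Dθ^[4] gF) p.1 p.2) (-gammaExp α)])
    refine h.trans ?_
    have E0 : ∀ n, 1 ≤ n → n + 0 ≤ 4 → eL2Sq (hkMixedTerm α n 0 gF) ≤ eHkNormSq α 4 gF := fun n hn hnj =>
      eL2Sq_hkMixedTerm_le α (k := 4) hn hnj gF
    calc _ ≤ ENNReal.ofReal 1 * eHkNormSq α 4 gF + ENNReal.ofReal 0 * eHkNormSq α 4 gF +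
          ENNReal.ofReal 0 * eHkNormSq α 4 gF + ENNReal.ofReal 0 * eHkNormSq α 4 gF :=
          add_le_add (add_le_add (add_le_add (mul_le_mul_right (E0 1 (by norm_num) (by norm_num)) _) (by rw [ENNReal.ofReal_zero, zero_mul, zero_mul])) (by rw [ENNReal.ofReal_zero, zero_mul, zero_mul])) (by rw [ENNReal.ofReal_zero, zero_mul, zero_mul])
      _ = ENNReal.ofReal (1 + 0 + 0 + 0) * eHkNormSq α 4 gF := by
          rw [ENNReal.ofReal_add (by norm_num) (by norm_num), ENNReal.ofReal_add (by norm_num) (by norm_num), ENNReal.ofReal_add (by norm_num) (by norm_num)]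
          ring
      _ ≤ ENNReal.ofReal 689220 * eHkNormSq α 4 gF := mul_le_mul_left (ENNReal.ofReal_le_ofReal (by norm_num)) _
  have dat_F11 : ENNReal.ofReal (∫ p in strip, radialWeight p.1 ^ 2 * dθ (Dz^[1] gF) p.1 p.2 ^ 2 * Real.sin (2 * p.2) ^ (2 - gammaExp α)) ≤ ENNReal.ofReal 689220 * eHkNormSq α 4 gF := by
    have ieq : IntegrableOn (fun p : ℝ × ℝ => radialWeight p.1 ^ 2 * dθ (Dz^[1] gF) p.1 p.2 ^ 2 * Real.sin (2 * p.2) ^ (2 - gammaExp α)) strip := by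
      have := iRpow (cF 1 1 (by norm_num)) (sF 1 1) (pF 1 1) hr0_1
      try simp only [Nat.reduceAdd, Nat.reduceMul, Nat.reducePow, Nat.cast_one, Nat.cast_ofNat, Finset.sum_range_succ, Finset.sum_range_zero, zero_add, Function.iterate_zero, id_eq, iterate_dθ_one, iterate_dθ_two] at this
      exact this
    have h := ofReal_setIntegral_le_add4 (H := fun p : ℝ × ℝ => radialWeight p.1 ^ 2 * dθ (Dz^[1] gF) p.1 p.2 ^ 2 * Real.sin (2 * p.2) ^ (2 - gammaExp α)) ieq (fun p hp => nnW p hp _ _)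
      (G₁ := hkMixedTerm α 1 1 gF) (G₂ := hkMixedTerm α 2 1 gF) (G₃ := hkMixedTerm α 3 1 gF) (G₄ := hkMixedTerm α 4 1 gF)
      (c₁ := 1) (c₂ := 0) (c₃ := 0) (c₄ := 0) (by norm_num) (by norm_num) (by norm_num) (by norm_num)
      (mF 1 1 (by norm_num)) (mF 2 1 (by norm_num)) (mF 3 1 (by norm_num)) (mF 4 1 (by norm_num))
      (fun p hp => by
        show radialWeight p.1 ^ 2 * dθ (Dz^[1] gF) p.1 p.2 ^ 2 * Real.sin (2 * p.2) ^ (2 - gammaExp α) ≤ _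
        rw [sq_hkMixedTerm α 1 1 _ hp, sq_hkMixedTerm α 2 1 _ hp, sq_hkMixedTerm α 3 1 _ hp, sq_hkMixedTerm α 4 1 _ hp]
        have dn := down_one (regF4 1 (by norm_num)) (gammaExp α) hp
        try simp only [Nat.reduceAdd, Nat.reduceMul, Nat.reducePow, Nat.cast_one, Nat.cast_ofNat, Finset.sum_range_succ, Finset.sum_range_zero, zero_add, Function.iterate_zero, id_eq, iterate_dθ_one, iterate_dθ_two] at dn ⊢
        nlinarith only [dn, nnW p hp ((Dθ^[1] (Dz^[1] gF)) p.1 p.2) (-gammaExp α), nnW p hp ((Dθ^[2] (Dz^[1] gF)) p.1 p.2) (-gammaExp α),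
          nnW p hp ((Dθ^[3] (Dz^[1] gF)) p.1 p.2) (-gammaExp α), nnW p hp ((Dθ^[4] (Dz^[1] gF)) p.1 p.2) (-gammaExp α)])
    refine h.trans ?_
    have E0 : ∀ n, 1 ≤ n → n + 1 ≤ 4 → eL2Sq (hkMixedTerm α n 1 gF) ≤ eHkNormSq α 4 gF := fun n hn hnj =>
      eL2Sq_hkMixedTerm_le α (k := 4) hn hnj gF
    calc _ ≤ ENNReal.ofReal 1 * eHkNormSq α 4 gF + ENNReal.ofReal 0 * eHkNormSq α 4 gF +
          ENNReal.ofReal 0 * eHkNormSq α 4 gF + ENNReal.ofReal 0 * eHkNormSq α 4 gF :=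
          add_le_add (add_le_add (add_le_add (mul_le_mul_right (E0 1 (by norm_num) (by norm_num)) _) (by rw [ENNReal.ofReal_zero, zero_mul, zero_mul])) (by rw [ENNReal.ofReal_zero, zero_mul, zero_mul])) (by rw [ENNReal.ofReal_zero, zero_mul, zero_mul])
      _ = ENNReal.ofReal (1 + 0 + 0 + 0) * eHkNormSq α 4 gF := by
          rw [ENNReal.ofReal_add (by norm_num) (by norm_num), ENNReal.ofReal_add (by norm_num) (by norm_num), ENNReal.ofReal_add (by norm_num) (by norm_num)]
          ring
      _ ≤ ENNReal.ofReal 689220 * eHkNormSq α 4 gF := mul_le_mul_left (ENNReal.ofReal_le_ofReal (by norm_num)) _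
  have dat_F12 : ENNReal.ofReal (∫ p in strip, radialWeight p.1 ^ 2 * dθ (Dz^[2] gF) p.1 p.2 ^ 2 * Real.sin (2 * p.2) ^ (2 - gammaExp α)) ≤ ENNReal.ofReal 689220 * eHkNormSq α 4 gF := by
    have ieq : IntegrableOn (fun p : ℝ × ℝ => radialWeight p.1 ^ 2 * dθ (Dz^[2] gF) p.1 p.2 ^ 2 * Real.sin (2 * p.2) ^ (2 - gammaExp α)) strip := by
      have := iRpow (cF 1 2 (by norm_num)) (sF 1 2) (pF 1 2) hr0_1
      try simp only [Nat.reduceAdd, Nat.reduceMul, Nat.reducePow, Nat.cast_one, Nat.cast_ofNat, Finset.sum_range_succ, Finset.sum_range_zero, zero_add, Function.iterate_zero, id_eq, iterate_dθ_one, iterate_dθ_two] at this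
      exact this
    have h := ofReal_setIntegral_le_add4 (H := fun p : ℝ × ℝ => radialWeight p.1 ^ 2 * dθ (Dz^[2] gF) p.1 p.2 ^ 2 * Real.sin (2 * p.2) ^ (2 - gammaExp α)) ieq (fun p hp => nnW p hp _ _)
      (G₁ := hkMixedTerm α 1 2 gF) (G₂ := hkMixedTerm α 2 2 gF) (G₃ := hkMixedTerm α 3 2 gF) (G₄ := hkMixedTerm α 4 2 gF)
      (c₁ := 1) (c₂ := 0) (c₃ := 0) (c₄ := 0) (by norm_num) (by norm_num) (by norm_num) (by norm_num)
      (mF 1 2 (by norm_num)) (mF 2 2 (by norm_num)) (mF 3 2 (by norm_num)) (mF 4 2 (by norm_num))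
      (fun p hp => by
        show radialWeight p.1 ^ 2 * dθ (Dz^[2] gF) p.1 p.2 ^ 2 * Real.sin (2 * p.2) ^ (2 - gammaExp α) ≤ _
        rw [sq_hkMixedTerm α 1 2 _ hp, sq_hkMixedTerm α 2 2 _ hp, sq_hkMixedTerm α 3 2 _ hp, sq_hkMixedTerm α 4 2 _ hp]
        have dn := down_one (regF4 2 (by norm_num)) (gammaExp α) hp
        try simp only [Nat.reduceAdd, Nat.reduceMul, Nat.reducePow, Nat.cast_one, Nat.cast_ofNat, Finset.sum_range_succ, Finset.sum_range_zero, zero_add, Function.iterate_zero, id_eq, iterate_dθ_one, iterate_dθ_two] at dn ⊢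
        nlinarith only [dn, nnW p hp ((Dθ^[1] (Dz^[2] gF)) p.1 p.2) (-gammaExp α), nnW p hp ((Dθ^[2] (Dz^[2] gF)) p.1 p.2) (-gammaExp α),
          nnW p hp ((Dθ^[3] (Dz^[2] gF)) p.1 p.2) (-gammaExp α), nnW p hp ((Dθ^[4] (Dz^[2] gF)) p.1 p.2) (-gammaExp α)])
    refine h.trans ?_
    have E0 : ∀ n, 1 ≤ n → n + 2 ≤ 4 → eL2Sq (hkMixedTerm α n 2 gF) ≤ eHkNormSq α 4 gF := fun n hn hnj =>
      eL2Sq_hkMixedTerm_le α (k := 4) hn hnj gF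
    calc _ ≤ ENNReal.ofReal 1 * eHkNormSq α 4 gF + ENNReal.ofReal 0 * eHkNormSq α 4 gF +
          ENNReal.ofReal 0 * eHkNormSq α 4 gF + ENNReal.ofReal 0 * eHkNormSq α 4 gF :=
          add_le_add (add_le_add (add_le_add (mul_le_mul_right (E0 1 (by norm_num) (by norm_num)) _) (by rw [ENNReal.ofReal_zero, zero_mul, zero_mul])) (by rw [ENNReal.ofReal_zero, zero_mul, zero_mul])) (by rw [ENNReal.ofReal_zero, zero_mul, zero_mul])
      _ = ENNReal.ofReal (1 + 0 + 0 + 0) * eHkNormSq α 4 gF := by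
          rw [ENNReal.ofReal_add (by norm_num) (by norm_num), ENNReal.ofReal_add (by norm_num) (by norm_num), ENNReal.ofReal_add (by norm_num) (by norm_num)]
          ring
      _ ≤ ENNReal.ofReal 689220 * eHkNormSq α 4 gF := mul_le_mul_left (ENNReal.ofReal_le_ofReal (by norm_num)) _
  have dat_F13 : ENNReal.ofReal (∫ p in strip, radialWeight p.1 ^ 2 * dθ (Dz^[3] gF) p.1 p.2 ^ 2 * Real.sin (2 * p.2) ^ (2 - gammaExp α)) ≤ ENNReal.ofReal 689220 * eHkNormSq α 4 gF := by
    have ieq : IntegrableOn (fun p : ℝ × ℝ => radialWeight p.1 ^ 2 * dθ (Dz^[3] gF) p.1 p.2 ^ 2 * Real.sin (2 * p.2) ^ (2 - gammaExp α)) strip := by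
      have := iRpow (cF 1 3 (by norm_num)) (sF 1 3) (pF 1 3) hr0_1
      try simp only [Nat.reduceAdd, Nat.reduceMul, Nat.reducePow, Nat.cast_one, Nat.cast_ofNat, Finset.sum_range_succ, Finset.sum_range_zero, zero_add, Function.iterate_zero, id_eq, iterate_dθ_one, iterate_dθ_two] at this
      exact this
    have h := ofReal_setIntegral_le_add4 (H := fun p : ℝ × ℝ => radialWeight p.1 ^ 2 * dθ (Dz^[3] gF) p.1 p.2 ^ 2 * Real.sin (2 * p.2) ^ (2 - gammaExp α)) ieq (fun p hp => nnW p hp _ _)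
      (G₁ := hkMixedTerm α 1 3 gF) (G₂ := hkMixedTerm α 2 3 gF) (G₃ := hkMixedTerm α 3 3 gF) (G₄ := hkMixedTerm α 4 3 gF)
      (c₁ := 1) (c₂ := 0) (c₃ := 0) (c₄ := 0) (by norm_num) (by norm_num) (by norm_num) (by norm_num)
      (mF 1 3 (by norm_num)) (mF 2 3 (by norm_num)) (mF 3 3 (by norm_num)) (mF 4 3 (by norm_num))
      (fun p hp => by
        show radialWeight p.1 ^ 2 * dθ (Dz^[3] gF) p.1 p.2 ^ 2 * Real.sin (2 * p.2) ^ (2 - gammaExp α) ≤ _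
        rw [sq_hkMixedTerm α 1 3 _ hp, sq_hkMixedTerm α 2 3 _ hp, sq_hkMixedTerm α 3 3 _ hp, sq_hkMixedTerm α 4 3 _ hp]
        have dn := down_one (regF4 3 (by norm_num)) (gammaExp α) hp
        try simp only [Nat.reduceAdd, Nat.reduceMul, Nat.reducePow, Nat.cast_one, Nat.cast_ofNat, Finset.sum_range_succ, Finset.sum_range_zero, zero_add, Function.iterate_zero, id_eq, iterate_dθ_one, iterate_dθ_two] at dn ⊢
        nlinarith only [dn, nnW p hp ((Dθ^[1] (Dz^[3] gF)) p.1 p.2) (-gammaExp α), nnW p hp ((Dθ^[2] (Dz^[3] gF)) p.1 p.2) (-gammaExp α),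
          nnW p hp ((Dθ^[3] (Dz^[3] gF)) p.1 p.2) (-gammaExp α), nnW p hp ((Dθ^[4] (Dz^[3] gF)) p.1 p.2) (-gammaExp α)])
    refine h.trans ?_
    have E0 : ∀ n, 1 ≤ n → n + 3 ≤ 4 → eL2Sq (hkMixedTerm α n 3 gF) ≤ eHkNormSq α 4 gF := fun n hn hnj =>
      eL2Sq_hkMixedTerm_le α (k := 4) hn hnj gF
    calc _ ≤ ENNReal.ofReal 1 * eHkNormSq α 4 gF + ENNReal.ofReal 0 * eHkNormSq α 4 gF +
          ENNReal.ofReal 0 * eHkNormSq α 4 gF + ENNReal.ofReal 0 * eHkNormSq α 4 gF :=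
          add_le_add (add_le_add (add_le_add (mul_le_mul_right (E0 1 (by norm_num) (by norm_num)) _) (by rw [ENNReal.ofReal_zero, zero_mul, zero_mul])) (by rw [ENNReal.ofReal_zero, zero_mul, zero_mul])) (by rw [ENNReal.ofReal_zero, zero_mul, zero_mul])
      _ = ENNReal.ofReal (1 + 0 + 0 + 0) * eHkNormSq α 4 gF := by
          rw [ENNReal.ofReal_add (by norm_num) (by norm_num), ENNReal.ofReal_add (by norm_num) (by norm_num), ENNReal.ofReal_add (by norm_num) (by norm_num)]
          ring
      _ ≤ ENNReal.ofReal 689220 * eHkNormSq α 4 gF := mul_le_mul_left (ENNReal.ofReal_le_ofReal (by norm_num)) _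
  have dat_F20 : ENNReal.ofReal (∫ p in strip, radialWeight p.1 ^ 2 * dθ (dθ gF) p.1 p.2 ^ 2 * Real.sin (2 * p.2) ^ (4 - gammaExp α)) ≤ ENNReal.ofReal 689220 * eHkNormSq α 4 gF := by
    have ieq : IntegrableOn (fun p : ℝ × ℝ => radialWeight p.1 ^ 2 * dθ (dθ gF) p.1 p.2 ^ 2 * Real.sin (2 * p.2) ^ (4 - gammaExp α)) strip := by
      have := iRpow (cF 2 0 (by norm_num)) (sF 2 0) (pF 2 0) hr0_2
      try simp only [Nat.reduceAdd, Nat.reduceMul, Nat.reducePow, Nat.cast_one, Nat.cast_ofNat, Finset.sum_range_succ, Finset.sum_range_zero, zero_add, Function.iterate_zero, id_eq, iterate_dθ_one, iterate_dθ_two] at this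
      exact this
    have h := ofReal_setIntegral_le_add4 (H := fun p : ℝ × ℝ => radialWeight p.1 ^ 2 * dθ (dθ gF) p.1 p.2 ^ 2 * Real.sin (2 * p.2) ^ (4 - gammaExp α)) ieq (fun p hp => nnW p hp _ _)
      (G₁ := hkMixedTerm α 1 0 gF) (G₂ := hkMixedTerm α 2 0 gF) (G₃ := hkMixedTerm α 3 0 gF) (G₄ := hkMixedTerm α 4 0 gF)
      (c₁ := 8) (c₂ := 2) (c₃ := 0) (c₄ := 0) (by norm_num) (by norm_num) (by norm_num) (by norm_num)
      (mF 1 0 (by norm_num)) (mF 2 0 (by norm_num)) (mF 3 0 (by norm_num)) (mF 4 0 (by norm_num))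
      (fun p hp => by
        show radialWeight p.1 ^ 2 * dθ (dθ gF) p.1 p.2 ^ 2 * Real.sin (2 * p.2) ^ (4 - gammaExp α) ≤ _
        rw [sq_hkMixedTerm α 1 0 _ hp, sq_hkMixedTerm α 2 0 _ hp, sq_hkMixedTerm α 3 0 _ hp, sq_hkMixedTerm α 4 0 _ hp]
        have dn := down_two (regF4 0 (by norm_num)) (gammaExp α) hp
        try simp only [Nat.reduceAdd, Nat.reduceMul, Nat.reducePow, Nat.cast_one, Nat.cast_ofNat, Finset.sum_range_succ, Finset.sum_range_zero, zero_add, Function.iterate_zero, id_eq, iterate_dθ_one, iterate_dθ_two] at dn ⊢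
        nlinarith only [dn, nnW p hp ((Dθ^[1] gF) p.1 p.2) (-gammaExp α), nnW p hp ((Dθ^[2] gF) p.1 p.2) (-gammaExp α),
          nnW p hp ((Dθ^[3] gF) p.1 p.2) (-gammaExp α), nnW p hp ((Dθ^[4] gF) p.1 p.2) (-gammaExp α)])
    refine h.trans ?_
    have E0 : ∀ n, 1 ≤ n → n + 0 ≤ 4 → eL2Sq (hkMixedTerm α n 0 gF) ≤ eHkNormSq α 4 gF := fun n hn hnj =>
      eL2Sq_hkMixedTerm_le α (k := 4) hn hnj gF
    calc _ ≤ ENNReal.ofReal 8 * eHkNormSq α 4 gF + ENNReal.ofReal 2 * eHkNormSq α 4 gF +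
          ENNReal.ofReal 0 * eHkNormSq α 4 gF + ENNReal.ofReal 0 * eHkNormSq α 4 gF :=
          add_le_add (add_le_add (add_le_add (mul_le_mul_right (E0 1 (by norm_num) (by norm_num)) _) (mul_le_mul_right (E0 2 (by norm_num) (by norm_num)) _)) (by rw [ENNReal.ofReal_zero, zero_mul, zero_mul])) (by rw [ENNReal.ofReal_zero, zero_mul, zero_mul])
      _ = ENNReal.ofReal (8 + 2 + 0 + 0) * eHkNormSq α 4 gF := by
          rw [ENNReal.ofReal_add (by norm_num) (by norm_num), ENNReal.ofReal_add (by norm_num) (by norm_num), ENNReal.ofReal_add (by norm_num) (by norm_num)]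
          ring
      _ ≤ ENNReal.ofReal 689220 * eHkNormSq α 4 gF := mul_le_mul_left (ENNReal.ofReal_le_ofReal (by norm_num)) _
  have dat_F21 : ENNReal.ofReal (∫ p in strip, radialWeight p.1 ^ 2 * dθ (dθ (Dz^[1] gF)) p.1 p.2 ^ 2 * Real.sin (2 * p.2) ^ (4 - gammaExp α)) ≤ ENNReal.ofReal 689220 * eHkNormSq α 4 gF := by
    have ieq : IntegrableOn (fun p : ℝ × ℝ => radialWeight p.1 ^ 2 * dθ (dθ (Dz^[1] gF)) p.1 p.2 ^ 2 * Real.sin (2 * p.2) ^ (4 - gammaExp α)) strip := by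
      have := iRpow (cF 2 1 (by norm_num)) (sF 2 1) (pF 2 1) hr0_2
      try simp only [Nat.reduceAdd, Nat.reduceMul, Nat.reducePow, Nat.cast_one, Nat.cast_ofNat, Finset.sum_range_succ, Finset.sum_range_zero, zero_add, Function.iterate_zero, id_eq, iterate_dθ_one, iterate_dθ_two] at this
      exact this
    have h := ofReal_setIntegral_le_add4 (H := fun p : ℝ × ℝ => radialWeight p.1 ^ 2 * dθ (dθ (Dz^[1] gF)) p.1 p.2 ^ 2 * Real.sin (2 * p.2) ^ (4 - gammaExp α)) ieq (fun p hp => nnW p hp _ _)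
      (G₁ := hkMixedTerm α 1 1 gF) (G₂ := hkMixedTerm α 2 1 gF) (G₃ := hkMixedTerm α 3 1 gF) (G₄ := hkMixedTerm α 4 1 gF)
      (c₁ := 8) (c₂ := 2) (c₃ := 0) (c₄ := 0) (by norm_num) (by norm_num) (by norm_num) (by norm_num)
      (mF 1 1 (by norm_num)) (mF 2 1 (by norm_num)) (mF 3 1 (by norm_num)) (mF 4 1 (by norm_num))
      (fun p hp => by
        show radialWeight p.1 ^ 2 * dθ (dθ (Dz^[1] gF)) p.1 p.2 ^ 2 * Real.sin (2 * p.2) ^ (4 - gammaExp α) ≤ _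
        rw [sq_hkMixedTerm α 1 1 _ hp, sq_hkMixedTerm α 2 1 _ hp, sq_hkMixedTerm α 3 1 _ hp, sq_hkMixedTerm α 4 1 _ hp]
        have dn := down_two (regF4 1 (by norm_num)) (gammaExp α) hp
        try simp only [Nat.reduceAdd, Nat.reduceMul, Nat.reducePow, Nat.cast_one, Nat.cast_ofNat, Finset.sum_range_succ, Finset.sum_range_zero, zero_add, Function.iterate_zero, id_eq, iterate_dθ_one, iterate_dθ_two] at dn ⊢
        nlinarith only [dn, nnW p hp ((Dθ^[1] (Dz^[1] gF)) p.1 p.2) (-gammaExp α), nnW p hp ((Dθ^[2] (Dz^[1] gF)) p.1 p.2) (-gammaExp α),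
          nnW p hp ((Dθ^[3] (Dz^[1] gF)) p.1 p.2) (-gammaExp α), nnW p hp ((Dθ^[4] (Dz^[1] gF)) p.1 p.2) (-gammaExp α)])
    refine h.trans ?_
    have E0 : ∀ n, 1 ≤ n → n + 1 ≤ 4 → eL2Sq (hkMixedTerm α n 1 gF) ≤ eHkNormSq α 4 gF := fun n hn hnj =>
      eL2Sq_hkMixedTerm_le α (k := 4) hn hnj gF
    calc _ ≤ ENNReal.ofReal 8 * eHkNormSq α 4 gF + ENNReal.ofReal 2 * eHkNormSq α 4 gF +
          ENNReal.ofReal 0 * eHkNormSq α 4 gF + ENNReal.ofReal 0 * eHkNormSq α 4 gF :=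
          add_le_add (add_le_add (add_le_add (mul_le_mul_right (E0 1 (by norm_num) (by norm_num)) _) (mul_le_mul_right (E0 2 (by norm_num) (by norm_num)) _)) (by rw [ENNReal.ofReal_zero, zero_mul, zero_mul])) (by rw [ENNReal.ofReal_zero, zero_mul, zero_mul])
      _ = ENNReal.ofReal (8 + 2 + 0 + 0) * eHkNormSq α 4 gF := by
          rw [ENNReal.ofReal_add (by norm_num) (by norm_num), ENNReal.ofReal_add (by norm_num) (by norm_num), ENNReal.ofReal_add (by norm_num) (by norm_num)]
          ring
      _ ≤ ENNReal.ofReal 689220 * eHkNormSq α 4 gF := mul_le_mul_left (ENNReal.ofReal_le_ofReal (by norm_num)) _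
  have dat_F22 : ENNReal.ofReal (∫ p in strip, radialWeight p.1 ^ 2 * dθ (dθ (Dz^[2] gF)) p.1 p.2 ^ 2 * Real.sin (2 * p.2) ^ (4 - gammaExp α)) ≤ ENNReal.ofReal 689220 * eHkNormSq α 4 gF := by
    have ieq : IntegrableOn (fun p : ℝ × ℝ => radialWeight p.1 ^ 2 * dθ (dθ (Dz^[2] gF)) p.1 p.2 ^ 2 * Real.sin (2 * p.2) ^ (4 - gammaExp α)) strip := by
      have := iRpow (cF 2 2 (by norm_num)) (sF 2 2) (pF 2 2) hr0_2
      try simp only [Nat.reduceAdd, Nat.reduceMul, Nat.reducePow, Nat.cast_one, Nat.cast_ofNat, Finset.sum_range_succ, Finset.sum_range_zero, zero_add, Function.iterate_zero, id_eq, iterate_dθ_one, iterate_dθ_two] at this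
      exact this
    have h := ofReal_setIntegral_le_add4 (H := fun p : ℝ × ℝ => radialWeight p.1 ^ 2 * dθ (dθ (Dz^[2] gF)) p.1 p.2 ^ 2 * Real.sin (2 * p.2) ^ (4 - gammaExp α)) ieq (fun p hp => nnW p hp _ _)
      (G₁ := hkMixedTerm α 1 2 gF) (G₂ := hkMixedTerm α 2 2 gF) (G₃ := hkMixedTerm α 3 2 gF) (G₄ := hkMixedTerm α 4 2 gF)
      (c₁ := 8) (c₂ := 2) (c₃ := 0) (c₄ := 0) (by norm_num) (by norm_num) (by norm_num) (by norm_num)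
      (mF 1 2 (by norm_num)) (mF 2 2 (by norm_num)) (mF 3 2 (by norm_num)) (mF 4 2 (by norm_num))
      (fun p hp => by
        show radialWeight p.1 ^ 2 * dθ (dθ (Dz^[2] gF)) p.1 p.2 ^ 2 * Real.sin (2 * p.2) ^ (4 - gammaExp α) ≤ _
        rw [sq_hkMixedTerm α 1 2 _ hp, sq_hkMixedTerm α 2 2 _ hp, sq_hkMixedTerm α 3 2 _ hp, sq_hkMixedTerm α 4 2 _ hp]
        have dn := down_two (regF4 2 (by norm_num)) (gammaExp α) hp
        try simp only [Nat.reduceAdd, Nat.reduceMul, Nat.reducePow, Nat.cast_one, Nat.cast_ofNat, Finset.sum_range_succ, Finset.sum_range_zero, zero_add, Function.iterate_zero, id_eq, iterate_dθ_one, iterate_dθ_two] at dn ⊢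
        nlinarith only [dn, nnW p hp ((Dθ^[1] (Dz^[2] gF)) p.1 p.2) (-gammaExp α), nnW p hp ((Dθ^[2] (Dz^[2] gF)) p.1 p.2) (-gammaExp α),
          nnW p hp ((Dθ^[3] (Dz^[2] gF)) p.1 p.2) (-gammaExp α), nnW p hp ((Dθ^[4] (Dz^[2] gF)) p.1 p.2) (-gammaExp α)])
    refine h.trans ?_
    have E0 : ∀ n, 1 ≤ n → n + 2 ≤ 4 → eL2Sq (hkMixedTerm α n 2 gF) ≤ eHkNormSq α 4 gF := fun n hn hnj =>
      eL2Sq_hkMixedTerm_le α (k := 4) hn hnj gF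
    calc _ ≤ ENNReal.ofReal 8 * eHkNormSq α 4 gF + ENNReal.ofReal 2 * eHkNormSq α 4 gF +
          ENNReal.ofReal 0 * eHkNormSq α 4 gF + ENNReal.ofReal 0 * eHkNormSq α 4 gF :=
          add_le_add (add_le_add (add_le_add (mul_le_mul_right (E0 1 (by norm_num) (by norm_num)) _) (mul_le_mul_right (E0 2 (by norm_num) (by norm_num)) _)) (by rw [ENNReal.ofReal_zero, zero_mul, zero_mul])) (by rw [ENNReal.ofReal_zero, zero_mul, zero_mul])
      _ = ENNReal.ofReal (8 + 2 + 0 + 0) * eHkNormSq α 4 gF := by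
          rw [ENNReal.ofReal_add (by norm_num) (by norm_num), ENNReal.ofReal_add (by norm_num) (by norm_num), ENNReal.ofReal_add (by norm_num) (by norm_num)]
          ring
      _ ≤ ENNReal.ofReal 689220 * eHkNormSq α 4 gF := mul_le_mul_left (ENNReal.ofReal_le_ofReal (by norm_num)) _
  have dat_F30 : ENNReal.ofReal (∫ p in strip, radialWeight p.1 ^ 2 * (dθ^[3] gF) p.1 p.2 ^ 2 * Real.sin (2 * p.2) ^ (6 - gammaExp α)) ≤ ENNReal.ofReal 689220 * eHkNormSq α 4 gF := by
    have ieq : IntegrableOn (fun p : ℝ × ℝ => radialWeight p.1 ^ 2 * (dθ^[3] gF) p.1 p.2 ^ 2 * Real.sin (2 * p.2) ^ (6 - gammaExp α)) strip := by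
      have := iRpow (cF 3 0 (by norm_num)) (sF 3 0) (pF 3 0) hr0_3
      try simp only [Nat.reduceAdd, Nat.reduceMul, Nat.reducePow, Nat.cast_one, Nat.cast_ofNat, Finset.sum_range_succ, Finset.sum_range_zero, zero_add, Function.iterate_zero, id_eq, iterate_dθ_one, iterate_dθ_two] at this
      exact this
    have h := ofReal_setIntegral_le_add4 (H := fun p : ℝ × ℝ => radialWeight p.1 ^ 2 * (dθ^[3] gF) p.1 p.2 ^ 2 * Real.sin (2 * p.2) ^ (6 - gammaExp α)) ieq (fun p hp => nnW p hp _ _)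
      (G₁ := hkMixedTerm α 1 0 gF) (G₂ := hkMixedTerm α 2 0 gF) (G₃ := hkMixedTerm α 3 0 gF) (G₄ := hkMixedTerm α 4 0 gF)
      (c₁ := 912) (c₂ := 216) (c₃ := 3) (c₄ := 0) (by norm_num) (by norm_num) (by norm_num) (by norm_num)
      (mF 1 0 (by norm_num)) (mF 2 0 (by norm_num)) (mF 3 0 (by norm_num)) (mF 4 0 (by norm_num))
      (fun p hp => by
        show radialWeight p.1 ^ 2 * (dθ^[3] gF) p.1 p.2 ^ 2 * Real.sin (2 * p.2) ^ (6 - gammaExp α) ≤ _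
        rw [sq_hkMixedTerm α 1 0 _ hp, sq_hkMixedTerm α 2 0 _ hp, sq_hkMixedTerm α 3 0 _ hp, sq_hkMixedTerm α 4 0 _ hp]
        have dn := down_three (regF4 0 (by norm_num)) (gammaExp α) hp
        try simp only [Nat.reduceAdd, Nat.reduceMul, Nat.reducePow, Nat.cast_one, Nat.cast_ofNat, Finset.sum_range_succ, Finset.sum_range_zero, zero_add, Function.iterate_zero, id_eq, iterate_dθ_one, iterate_dθ_two] at dn ⊢
        nlinarith only [dn, nnW p hp ((Dθ^[1] gF) p.1 p.2) (-gammaExp α), nnW p hp ((Dθ^[2] gF) p.1 p.2) (-gammaExp α),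
          nnW p hp ((Dθ^[3] gF) p.1 p.2) (-gammaExp α), nnW p hp ((Dθ^[4] gF) p.1 p.2) (-gammaExp α)])
    refine h.trans ?_
    have E0 : ∀ n, 1 ≤ n → n + 0 ≤ 4 → eL2Sq (hkMixedTerm α n 0 gF) ≤ eHkNormSq α 4 gF := fun n hn hnj =>
      eL2Sq_hkMixedTerm_le α (k := 4) hn hnj gF
    calc _ ≤ ENNReal.ofReal 912 * eHkNormSq α 4 gF + ENNReal.ofReal 216 * eHkNormSq α 4 gF +
          ENNReal.ofReal 3 * eHkNormSq α 4 gF + ENNReal.ofReal 0 * eHkNormSq α 4 gF :=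
          add_le_add (add_le_add (add_le_add (mul_le_mul_right (E0 1 (by norm_num) (by norm_num)) _) (mul_le_mul_right (E0 2 (by norm_num) (by norm_num)) _)) (mul_le_mul_right (E0 3 (by norm_num) (by norm_num)) _)) (by rw [ENNReal.ofReal_zero, zero_mul, zero_mul])
      _ = ENNReal.ofReal (912 + 216 + 3 + 0) * eHkNormSq α 4 gF := by
          rw [ENNReal.ofReal_add (by norm_num) (by norm_num), ENNReal.ofReal_add (by norm_num) (by norm_num), ENNReal.ofReal_add (by norm_num) (by norm_num)]
          ring
      _ ≤ ENNReal.ofReal 689220 * eHkNormSq α 4 gF := mul_le_mul_left (ENNReal.ofReal_le_ofReal (by norm_num)) _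
  have dat_F31 : ENNReal.ofReal (∫ p in strip, radialWeight p.1 ^ 2 * (dθ^[3] (Dz^[1] gF)) p.1 p.2 ^ 2 * Real.sin (2 * p.2) ^ (6 - gammaExp α)) ≤ ENNReal.ofReal 689220 * eHkNormSq α 4 gF := by
    have ieq : IntegrableOn (fun p : ℝ × ℝ => radialWeight p.1 ^ 2 * (dθ^[3] (Dz^[1] gF)) p.1 p.2 ^ 2 * Real.sin (2 * p.2) ^ (6 - gammaExp α)) strip := by
      have := iRpow (cF 3 1 (by norm_num)) (sF 3 1) (pF 3 1) hr0_3
      try simp only [Nat.reduceAdd, Nat.reduceMul, Nat.reducePow, Nat.cast_one, Nat.cast_ofNat, Finset.sum_range_succ, Finset.sum_range_zero, zero_add, Function.iterate_zero, id_eq, iterate_dθ_one, iterate_dθ_two] at this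
      exact this
    have h := ofReal_setIntegral_le_add4 (H := fun p : ℝ × ℝ => radialWeight p.1 ^ 2 * (dθ^[3] (Dz^[1] gF)) p.1 p.2 ^ 2 * Real.sin (2 * p.2) ^ (6 - gammaExp α)) ieq (fun p hp => nnW p hp _ _)
      (G₁ := hkMixedTerm α 1 1 gF) (G₂ := hkMixedTerm α 2 1 gF) (G₃ := hkMixedTerm α 3 1 gF) (G₄ := hkMixedTerm α 4 1 gF)
      (c₁ := 912) (c₂ := 216) (c₃ := 3) (c₄ := 0) (by norm_num) (by norm_num) (by norm_num) (by norm_num)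
      (mF 1 1 (by norm_num)) (mF 2 1 (by norm_num)) (mF 3 1 (by norm_num)) (mF 4 1 (by norm_num))
      (fun p hp => by
        show radialWeight p.1 ^ 2 * (dθ^[3] (Dz^[1] gF)) p.1 p.2 ^ 2 * Real.sin (2 * p.2) ^ (6 - gammaExp α) ≤ _
        rw [sq_hkMixedTerm α 1 1 _ hp, sq_hkMixedTerm α 2 1 _ hp, sq_hkMixedTerm α 3 1 _ hp, sq_hkMixedTerm α 4 1 _ hp]
        have dn := down_three (regF4 1 (by norm_num)) (gammaExp α) hp
        try simp only [Nat.reduceAdd, Nat.reduceMul, Nat.reducePow, Nat.cast_one, Nat.cast_ofNat, Finset.sum_range_succ, Finset.sum_range_zero, zero_add, Function.iterate_zero, id_eq, iterate_dθ_one, iterate_dθ_two] at dn ⊢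
        nlinarith only [dn, nnW p hp ((Dθ^[1] (Dz^[1] gF)) p.1 p.2) (-gammaExp α), nnW p hp ((Dθ^[2] (Dz^[1] gF)) p.1 p.2) (-gammaExp α),
          nnW p hp ((Dθ^[3] (Dz^[1] gF)) p.1 p.2) (-gammaExp α), nnW p hp ((Dθ^[4] (Dz^[1] gF)) p.1 p.2) (-gammaExp α)])
    refine h.trans ?_
    have E0 : ∀ n, 1 ≤ n → n + 1 ≤ 4 → eL2Sq (hkMixedTerm α n 1 gF) ≤ eHkNormSq α 4 gF := fun n hn hnj =>
      eL2Sq_hkMixedTerm_le α (k := 4) hn hnj gF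
    calc _ ≤ ENNReal.ofReal 912 * eHkNormSq α 4 gF + ENNReal.ofReal 216 * eHkNormSq α 4 gF +
          ENNReal.ofReal 3 * eHkNormSq α 4 gF + ENNReal.ofReal 0 * eHkNormSq α 4 gF :=
          add_le_add (add_le_add (add_le_add (mul_le_mul_right (E0 1 (by norm_num) (by norm_num)) _) (mul_le_mul_right (E0 2 (by norm_num) (by norm_num)) _)) (mul_le_mul_right (E0 3 (by norm_num) (by norm_num)) _)) (by rw [ENNReal.ofReal_zero, zero_mul, zero_mul])
      _ = ENNReal.ofReal (912 + 216 + 3 + 0) * eHkNormSq α 4 gF := by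
          rw [ENNReal.ofReal_add (by norm_num) (by norm_num), ENNReal.ofReal_add (by norm_num) (by norm_num), ENNReal.ofReal_add (by norm_num) (by norm_num)]
          ring
      _ ≤ ENNReal.ofReal 689220 * eHkNormSq α 4 gF := mul_le_mul_left (ENNReal.ofReal_le_ofReal (by norm_num)) _
  have dat_F40 : ENNReal.ofReal (∫ p in strip, radialWeight p.1 ^ 2 * (dθ^[4] gF) p.1 p.2 ^ 2 * Real.sin (2 * p.2) ^ (8 - gammaExp α)) ≤ ENNReal.ofReal 689220 * eHkNormSq α 4 gF := by
    have ieq : IntegrableOn (fun p : ℝ × ℝ => radialWeight p.1 ^ 2 * (dθ^[4] gF) p.1 p.2 ^ 2 * Real.sin (2 * p.2) ^ (8 - gammaExp α)) strip := by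
      have := iRpow (cF 4 0 (by norm_num)) (sF 4 0) (pF 4 0) hr0_4
      try simp only [Nat.reduceAdd, Nat.reduceMul, Nat.reducePow, Nat.cast_one, Nat.cast_ofNat, Finset.sum_range_succ, Finset.sum_range_zero, zero_add, Function.iterate_zero, id_eq, iterate_dθ_one, iterate_dθ_two] at this
      exact this
    have h := ofReal_setIntegral_le_add4 (H := fun p : ℝ × ℝ => radialWeight p.1 ^ 2 * (dθ^[4] gF) p.1 p.2 ^ 2 * Real.sin (2 * p.2) ^ (8 - gammaExp α)) ieq (fun p hp => nnW p hp _ _)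
      (G₁ := hkMixedTerm α 1 0 gF) (G₂ := hkMixedTerm α 2 0 gF) (G₃ := hkMixedTerm α 3 0 gF) (G₄ := hkMixedTerm α 4 0 gF)
      (c₁ := 556800) (c₂ := 130688) (c₃ := 1728) (c₄ := 4) (by norm_num) (by norm_num) (by norm_num) (by norm_num)
      (mF 1 0 (by norm_num)) (mF 2 0 (by norm_num)) (mF 3 0 (by norm_num)) (mF 4 0 (by norm_num))
      (fun p hp => by
        show radialWeight p.1 ^ 2 * (dθ^[4] gF) p.1 p.2 ^ 2 * Real.sin (2 * p.2) ^ (8 - gammaExp α) ≤ _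
        rw [sq_hkMixedTerm α 1 0 _ hp, sq_hkMixedTerm α 2 0 _ hp, sq_hkMixedTerm α 3 0 _ hp, sq_hkMixedTerm α 4 0 _ hp]
        have dn := down_four (regF4 0 (by norm_num)) (gammaExp α) hp
        try simp only [Nat.reduceAdd, Nat.reduceMul, Nat.reducePow, Nat.cast_one, Nat.cast_ofNat, Finset.sum_range_succ, Finset.sum_range_zero, zero_add, Function.iterate_zero, id_eq, iterate_dθ_one, iterate_dθ_two] at dn ⊢
        nlinarith only [dn, nnW p hp ((Dθ^[1] gF) p.1 p.2) (-gammaExp α), nnW p hp ((Dθ^[2] gF) p.1 p.2) (-gammaExp α),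
          nnW p hp ((Dθ^[3] gF) p.1 p.2) (-gammaExp α), nnW p hp ((Dθ^[4] gF) p.1 p.2) (-gammaExp α)])
    refine h.trans ?_
    have E0 : ∀ n, 1 ≤ n → n + 0 ≤ 4 → eL2Sq (hkMixedTerm α n 0 gF) ≤ eHkNormSq α 4 gF := fun n hn hnj =>
      eL2Sq_hkMixedTerm_le α (k := 4) hn hnj gF
    calc _ ≤ ENNReal.ofReal 556800 * eHkNormSq α 4 gF + ENNReal.ofReal 130688 * eHkNormSq α 4 gF +
          ENNReal.ofReal 1728 * eHkNormSq α 4 gF + ENNReal.ofReal 4 * eHkNormSq α 4 gF :=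
          add_le_add (add_le_add (add_le_add (mul_le_mul_right (E0 1 (by norm_num) (by norm_num)) _) (mul_le_mul_right (E0 2 (by norm_num) (by norm_num)) _)) (mul_le_mul_right (E0 3 (by norm_num) (by norm_num)) _)) (mul_le_mul_right (E0 4 (by norm_num) (by norm_num)) _)
      _ = ENNReal.ofReal (556800 + 130688 + 1728 + 4) * eHkNormSq α 4 gF := by
          rw [ENNReal.ofReal_add (by norm_num) (by norm_num), ENNReal.ofReal_add (by norm_num) (by norm_num), ENNReal.ofReal_add (by norm_num) (by norm_num)]
          ring
      _ ≤ ENNReal.ofReal 689220 * eHkNormSq α 4 gF := mul_le_mul_left (ENNReal.ofReal_le_ofReal (by norm_num)) _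
  rw [hD]
  have step : ENNReal.ofReal ((∫ p in strip, radialWeight p.1 ^ 2 * ellipticOp α Ψ p.1 p.2 ^ 2 * Real.sin (2 * p.2) ^ (-eta)) + (∫ p in strip, radialWeight p.1 ^ 2 * (Dz^[1] (ellipticOp α Ψ)) p.1 p.2 ^ 2 * Real.sin (2 * p.2) ^ (-eta)) + (∫ p in strip, radialWeight p.1 ^ 2 * (Dz^[2] (ellipticOp α Ψ)) p.1 p.2 ^ 2 * Real.sin (2 * p.2) ^ (-eta)) + (∫ p in strip, radialWeight p.1 ^ 2 * (Dz^[3] (ellipticOp α Ψ)) p.1 p.2 ^ 2 * Real.sin (2 * p.2) ^ (-eta)) + (∫ p in strip, radialWeight p.1 ^ 2 * (Dz^[4] (ellipticOp α Ψ)) p.1 p.2 ^ 2 * Real.sin (2 * p.2) ^ (-eta)) +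
        (∫ p in strip, radialWeight p.1 ^ 2 * dθ gF p.1 p.2 ^ 2 * Real.sin (2 * p.2) ^ (2 - gammaExp α)) +
        (∫ p in strip, radialWeight p.1 ^ 2 * dθ (Dz^[1] gF) p.1 p.2 ^ 2 * Real.sin (2 * p.2) ^ (2 - gammaExp α)) +
        (∫ p in strip, radialWeight p.1 ^ 2 * dθ (Dz^[2] gF) p.1 p.2 ^ 2 * Real.sin (2 * p.2) ^ (2 - gammaExp α)) +
        (∫ p in strip, radialWeight p.1 ^ 2 * dθ (Dz^[3] gF) p.1 p.2 ^ 2 * Real.sin (2 * p.2) ^ (2 - gammaExp α)) +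
        (∫ p in strip, radialWeight p.1 ^ 2 * dθ (dθ gF) p.1 p.2 ^ 2 * Real.sin (2 * p.2) ^ (4 - gammaExp α)) +
        (∫ p in strip, radialWeight p.1 ^ 2 * dθ (dθ (Dz^[1] gF)) p.1 p.2 ^ 2 * Real.sin (2 * p.2) ^ (4 - gammaExp α)) +
        (∫ p in strip, radialWeight p.1 ^ 2 * dθ (dθ (Dz^[2] gF)) p.1 p.2 ^ 2 * Real.sin (2 * p.2) ^ (4 - gammaExp α)) +
        (∫ p in strip, radialWeight p.1 ^ 2 * (dθ^[3] gF) p.1 p.2 ^ 2 * Real.sin (2 * p.2) ^ (6 - gammaExp α)) +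
        (∫ p in strip, radialWeight p.1 ^ 2 * (dθ^[3] (Dz^[1] gF)) p.1 p.2 ^ 2 * Real.sin (2 * p.2) ^ (6 - gammaExp α)) +
        (∫ p in strip, radialWeight p.1 ^ 2 * (dθ^[4] gF) p.1 p.2 ^ 2 * Real.sin (2 * p.2) ^ (8 - gammaExp α))) ≤
        (ENNReal.ofReal 689220 * eHkNormSq α 4 gF) + (ENNReal.ofReal 689220 * eHkNormSq α 4 gF) + (ENNReal.ofReal 689220 * eHkNormSq α 4 gF) + (ENNReal.ofReal 689220 * eHkNormSq α 4 gF) + (ENNReal.ofReal 689220 * eHkNormSq α 4 gF) + (ENNReal.ofReal 689220 * eHkNormSq α 4 gF) + (ENNReal.ofReal 689220 * eHkNormSq α 4 gF) + (ENNReal.ofReal 689220 * eHkNormSq α 4 gF) + (ENNReal.ofReal 689220 * eHkNormSq α 4 gF) + (ENNReal.ofReal 689220 * eHkNormSq α 4 gF) + (ENNReal.ofReal 689220 * eHkNormSq α 4 gF) + (ENNReal.ofReal 689220 * eHkNormSq α 4 gF) + (ENNReal.ofReal 689220 * eHkNormSq α 4 gF) + (ENNReal.ofReal 689220 * eHkNormSq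 α 4 gF) + (ENNReal.ofReal 689220 * eHkNormSq α 4 gF) := by
      refine ENNReal.ofReal_add_le.trans (add_le_add ?_ dat_F40)
      refine ENNReal.ofReal_add_le.trans (add_le_add ?_ dat_F31)
      refine ENNReal.ofReal_add_le.trans (add_le_add ?_ dat_F30)
      refine ENNReal.ofReal_add_le.trans (add_le_add ?_ dat_F22)
      refine ENNReal.ofReal_add_le.trans (add_le_add ?_ dat_F21)
      refine ENNReal.ofReal_add_le.trans (add_le_add ?_ dat_F20)
      refine ENNReal.ofReal_add_le.trans (add_le_add ?_ dat_F13)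
      refine ENNReal.ofReal_add_le.trans (add_le_add ?_ dat_F12)
      refine ENNReal.ofReal_add_le.trans (add_le_add ?_ dat_F11)
      refine ENNReal.ofReal_add_le.trans (add_le_add ?_ dat_F10)
      refine ENNReal.ofReal_add_le.trans (add_le_add ?_ dat_L4)
      refine ENNReal.ofReal_add_le.trans (add_le_add ?_ dat_L3)
      refine ENNReal.ofReal_add_le.trans (add_le_add ?_ dat_L2)
      refine ENNReal.ofReal_add_le.trans (add_le_add ?_ dat_L1)
      exact dat_L0
  refine step.trans (le_of_eq ?_)
  ring

end Elgindi

end Literature.Analysis.FluidPDE
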